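import Literature.MathematicalPhysics.QuantumFieldTheory.Balaban1983to89.T4OscSandwich

/-!
# `Balaban1983to89.T4JointDressing` — node O3b (ii) of the uniqueness spine: INTER-COMPONENT COUPLING OF A DRESSED TERM
INSIDE ONE UNIT BLOCK — the joint normalisation over `Λ₁ ∪ Λ₂` versus the product `∏ᵢ` of (1.100), the two-body Mayer step
that restores the product as a KERNEL THEOREM with an explicit coupling remainder, and the pair-sensitivity input NE1 (ii)
TYPED as a hypothesis shape (cell `pub-balaban`, T4-DAG v2 §5 row T4-O3.E-ii°, §2 O3b (ii), §6 NE1 (ii); kernel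
bookkeeping over `B15.BasicStep` / `T4DressedR` / `T4OscSandwich` / `T4AvgSensitivity`, `Setup` vocabulary)

HONEST FRAMING (cell `pub-balaban`, T4-DAG PAGE 1).  The cell's T4 target is the existence AND uniqueness of the
continuum limit of Bałaban's unit-scale averaged loop expectations on a finite torus — a constructive-QFT statement
strictly beyond ultraviolet stability ([Balaban1989LargeFieldII] Thm 1 p. 355); it is NOT the Yang–Mills mass gap and
NOT the Clay problem.  This module is the kernel half of ONE `EST` row (T4-O3.E-ii) of that spine; the paper-level half is
the cell file `t4/T4-EST-O3Eii.md`.  When ONE term of the basic renormalization operation (0.3)/(1.100) of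
[Balaban1989LargeFieldI] integrates the bond variables of SEVERAL components `Λ₁, …, Λ_p` of its large-field region and the
density carries the cell's observable dressing `w = exp(t·W_C∘avg^{K−k})` (a loop variable of the ITERATED AVERAGED field,
which is NOT a product over the components), the dressed joint normalisation over `∪ᵢΛᵢ` (the cell's convention (β),
T4-DAG v2 §1 D5) no longer factorises into the printed product `∏ᵢ` — this module says exactly by how much, at the
measure-theoretic level of the tree's concrete model (`B15.BasicStep.fibreIntegral` / `normTerm` = Mathlib `lmarginal` over
the product of the normalized Haar measures).  It asserts NOTHING about Bałaban's operations or averagings: every theorem is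
Fubini over a union of two disjoint fibres plus elementary monotonicity, and the cell's NEW estimate NE1 (ii) enters only as
the HYPOTHESIS SHAPE `LoopPairOscBound` (§4, NOT PRINTED) consumed in §5.  Value = typed shape + kernel bookkeeping (exactly
where a pair rate `θ₂ < θ_av` — or, v2 §6, a rate improving with the SEPARATION of the two components — would be spent at
ONE basic step, and that nothing else couples the components); NOT summit
progress, NOT the cell's estimate NE1 (dressed stability), NOT a proof of NE1 (ii), NOT the inductive polymer format of the
full (multi-step) expansion — see "Located items NOT touched" below.

CITATION HEADER (lean-in-tree rule 2026-08-18).  This seat re-read the RENDERS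
`b2b-balaban-ref1/pages/1989-cmp122-large-field-I/1989-cmp122-large-field-I-p002-x2.png` (journal p. 176) and
`-p027-x2.png` (p. 201) of T. Bałaban, *Large field renormalization. I. The basic step of the ℝ operation*, Commun. Math.
Phys. **122** (1989) 175–202 [Balaban1989LargeFieldI] (cell paper B15; PDF page = journal page − 174), and
`…/1989-cmp122-large-field-II/1989-cmp122-large-field-II-p024-x2.png` (p. 378) of T. Bałaban, *Large field
renormalization. II. Localization, exponentiation, and bounds for the ℝ operation*, Commun. Math. Phys. **122** (1989)
355–392 [Balaban1989LargeFieldII] (cell paper B16; PDF page = journal page − 354), and quotes VERBATIM: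
p. 176 (0.2) "ρ(V) = Σ_Z ρ(Z, V)", (0.3) "(ℝρ)(V) = Σ_Z ρ(Z″, V) ∫dV⌈_{Z′}ρ(Z, V) / ∫dV⌈_{Z′}ρ(Z″, V)", "We will prove
that the densities are positive, and the inegration [sic] domains in the integrals above are nonempty, hence the
denominators are positive, and the operation ℝ is well defined. It satisfies the basic normalization property
∫dV(ℝρ)(V) = ∫dVρ(V). (0.4)", and "We localize them, trying to decouple components of Z′, i.e., we write a polymer
expansion, and then we exponentiate it."; p. 201 "we write Z explicitly as a union of components, Z = X₁ ∪ ⋯ ∪ Xₙ, and we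
separate the summation over the admissible Z_k, n, X₁, …, Xₙ, from the remaining summations, which are factorized in those
domains.", "The integrations in (1.99) are also factorized in those components. This way we write the expression in (1.99)
in a form similar to a polymer expansion, suggesting explicitly localization operations and an exponentiation.", the
product structure "∏_{i=1}^{n} [ (1/Nᵢ) Σ … ∫dV′⌈_{Λᵢ} … ]" of (1.100), (1.101) "χ(Λᵢ) = χ({|(1/i) log V′(b)| < M₀ε_k for
b ∈ Λᵢ})" and (1.102) "The above operation has the fundamental normalization property ∫dV_k(ℝ′ρ_k)(V_k) = ∫dV_kρ_k(V_k).";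
p. 378 "To write its final form, we introduce a new T-operation. It is defined for a component of Z by a composition of the
integration in (1.70) localized in this component, and the integration together with the T_h-operation in (1.100) [IV], also
localized in this component. We use the fact that these integrations factorize in components of Z."  The manuscripts are
quoted for CONTEXT and SHAPE only (a term = an insert at the field times a fibre integral of the integrated expression over
its normalisation; the integrations of ONE term factorize over the components of its region) — no disputed estimate of them
is used anywhere below.  The pair-sensitivity hypothesis of §4 is the cell's typing around T. Bałaban, *Averaging operations
for lattice gauge theories*, Commun. Math. Phys. **98** (1985) 17–51 [Balaban1985Averaging] — render
`…/1985-cmp98-averaging/1985-cmp98-averaging-p003-x2.png`, p. 19: (11) "(Ū^u)(y, y′) = u(y)Ū(y, y′)u⁻¹(y′), or Ū^u = (Ū)^u."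
(gauge covariance) and (15) (the average `Ū_c` depends on `U` through the block `B(c₋)` and the contours `Γ_{c,x}` only —
the tree axiom `Setup.Averaging.local_dep`) — and is NOT PRINTED anywhere (T4-DAG v2 §2 O3c: B7 Props 1–3 are regularity
statements, not sensitivities); it is introduced as `def LoopPairOscBound … : Prop` and consumed only as a hypothesis.

THE ROW (T4-DAG v2 §5, verbatim; ° = new in v2): "T4-O3.E-ii° | O3b | EST | NE1 part (ii): inter-component coupling
inside one unit block — joint normalisation (β) over ∪_iΛ_i or a Mayer step restoring ∏_i of (1.100); the
observable-attached polymer format with power-law locality across 𝒯(C); which B13/B16 weighted-norm loci it must survive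
(from O3.X2) — `Prop` + sketch | B15 p.201; B13 (2.1)/(2.13) pp.12–14; B16 (1.89) p.387; BIJ88 §4; GK86 §6; BBS15
§3–4 (shape) | O3.X2 (soft) | L | | open" (v1 of this docstring omitted the SOURCES column without an ellipsis — XREAD
C-b07g5-3 (N1); T4-DAG v3 §5, published 2026-08-18T21:22:44Z, keeps this row text, appends the gloss "— v3: = X2's
obligation (A) / T4-REF-O3 V5 (iii): a Mayer PAIR class without d_k-decay between partners; criterion
sup_{X₁}Σ_{X₂}∣v₁₂∣·weights ≪ 1 per cube against the budget ≍ ∣μ∣g_j^{O(1)}M⁴(L⁴θ₁²φ²)^{K−j}" and records this unit as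
owner); kind EST = "formulate the new estimate as a Lean `Prop` with constants AND write the paper-level proof sketch with
every printed input cited by page (the estimate itself is expected to be beyond kernel reach — say so)".
The node text it serves (T4-DAG v2 §2 O3b (ii), verbatim): "(β) keeps it but couples all
components inside one unit block through ONE joint normalisation over ∪_iΛ_i (f_μ does not factor over i; B15 p.201 "The
integrations in (1.99) are also factorized in those components" FAILS for ρ_k·w with a non-abelian W_C over several Λ_i ⊂
𝒯(C) of one term, G-t4-O3X1-3): a Mayer step in the inter-component couplings (strength ≲ |μ|θ_av^{2(K−k)}|Λ_i||Λ_i′|)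
restores the product structure ∏_i of (1.100) at the price of OBSERVABLE-ATTACHED polymers with hierarchical power-law (not
e^{−κd_k}) locality across 𝒯(C)".

DICTIONARY (as in `B15.BasicStep` / `T4DressedR` / `T4OscSandwich`): a fibre `s : Finset (PBond P j)` = the bond
variables `Λ` integrated out; `V←y := Function.updateFinset V s y` runs over the FIBRE THROUGH `V`;
`fibreIntegral s f V = ∫dV′⌈_Λ f` (normalized Haar); `normTerm s ins old V = ins(V)·∫⌈_Λ old/∫⌈_Λ ins` = ONE term of
(0.3)/(1.100) with INSERT `ins = ρ(Z″,·)` and INTEGRATED expression `old = ρ(Z,·)`; two components of ONE term = two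
DISJOINT fibres `s₁ = Λ₁`, `s₂ = Λ₂` with per-component data `insᵢ, oldᵢ` INDEPENDENT of the other component's variables
(`T4DressedR.FibreIndep`), the printed factorised data being `ins = ins₁·ins₂`, `old = old₁·old₂`; convention (β) = ONE
`normTerm (s₁ ∪ s₂)`, the printed `∏ᵢ` = `normTerm s₁ … * normTerm s₂ …`; the dressing is `w = exp(t·F)`, in the cell's
use `F = T4OscSandwich.loopDressing av j n x w = W_C ∘ avg^n` (a level-`(j+n)` loop variable of the `n`-fold averaged
level-`j` field, `T4AvgSensitivity.iterFrom`), `t = μ`.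

WHAT IS PROVED (all [folklore]; hypotheses: measurability where Fubini is used, `0 ≤ density ≤ C`, `|F| ≤ B`).
§0 `updateFinset_updateFinset_comm`: coordinate updates on two DISJOINT finite sets commute.
§1 TWO-FIBRE SANDWICH `fibreIntegral_union_sandwich`: Fubini `∫dV⌈_{Λ₁∪Λ₂} = ∫dV⌈_{Λ₁}∫dV⌈_{Λ₂}` (Mathlib
   `lmarginal_union`) + pointwise comparison: if `cₗ·a(V←y)·b(V←z) ≤ g(V←y←z) ≤ cᵤ·a(V←y)·b(V←z)` on the joint fibre, then
   `cₗ·∫⌈_{Λ₁}a·∫⌈_{Λ₂}b ≤ ∫⌈_{Λ₁∪Λ₂}g ≤ cᵤ·∫⌈_{Λ₁}a·∫⌈_{Λ₂}b` at `V`.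
§2 THE PRINTED FACTORISATION AS A THEOREM: `fibreIntegral_union_mul_eq` (`∫⌈_{Λ₁∪Λ₂}(f₁f₂) = ∫⌈_{Λ₁}f₁·∫⌈_{Λ₂}f₂` for
   `fᵢ` independent of the other fibre — the kernel form of p. 201 l. 13 / p. 378); `normTerm_union_mul_eq`: for
   FACTORISED data the joint normalisation (β) over `Λ₁ ∪ Λ₂` EQUALS the product `∏_{i=1,2}` of the per-component
   normalised factors of (1.100); `normTerm_union_dressed_of_mul`: the same survives ANY dressing `w = w₁w₂` that
   factorises over the components ((α)-dressing inside the integrated factor, `T4DressedR.RopRealIn`).  HENCE ALL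
   inter-component coupling of a dressed term is the NON-MULTIPLICATIVITY of `w` across the components — for `w = e^{tF}`,
   the mixed second difference of `F`.
§3 THE TWO-BODY MAYER STEP: `exp_mixed_bounds` (real inequality); `fibreIntegral_union_exp_sandwich`: if
   `|F(V←y←z) − F(V←y) − F(V←z) + F(V)| ≤ δ` on the joint fibre through `V` (only where `old₁(V←y) ≠ 0 ≠ old₂(V←z)` — the
   small-field supports), then with `Nᵢ = ∫⌈_{Λᵢ}(oldᵢe^{tF})(V)`, `N₁₂ = ∫⌈_{Λ₁∪Λ₂}(old₁old₂e^{tF})(V)`: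
   `e^{−|t|δ}e^{−tF(V)}N₁N₂ ≤ N₁₂ ≤ e^{|t|δ}e^{−tF(V)}N₁N₂`; `fibreIntegral_exp_dressed_pos` (dressed fluctuation integrals
   are positive when the undressed ones are non-zero — the printed proviso p. 176); `abs_log_coupling_le`:
   `|log N₁₂ − log N₁ − log N₂ + tF(V)| ≤ |t|δ`; `abs_defect_union_sub_le`: in D-TERM form (any convention
   `D_Λ = log(∫⌈_Λ(old·e^{tF})/∫⌈_Λ old) − tF(V)`, the "dressing defect" of T4-DAG v2 §2 O3b (i) with base point `V`)
   `D_{Λ₁∪Λ₂} = D_{Λ₁} + D_{Λ₂} + R₁₂`, `|R₁₂| ≤ |t|δ`: the dressed joint term (β) = `∏ᵢ`(dressed component factors)·`e^{R₁₂}`.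
§4 NE1 (ii) TYPED: `LoopPairOscBound av dom C₂ θ₂` — for closed walks `(x, w)` at level `k + n ≤ m + K`, disjoint `Λ, Λ′`
   and every rectangle `V, V₁, V₂, V₁₂` in `dom k` (`V₁ = V` off `Λ`, `V₂ = V` off `Λ′`, `V₁₂ = V₁` off `Λ′`, `V₁₂ = V₂` off
   `Λ`): `|W(avg^n V₁₂) − W(avg^n V₁) − W(avg^n V₂) + W(avg^n V)| ≤ C₂·|w|·|Λ|·|Λ′|·θ₂^n`; `.mono`, `.anti`;
   `loopPairOscBound_of_loopOscBound`: NE1a `LoopOscBound av dom C_W θ` ⇒ `LoopPairOscBound av dom (2C_W) θ`;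
   `loopPairOscBound_four_one`: it holds TRIVIALLY with `(4, 1)` — so its content beyond NE1a is only a PAIR RATE `θ₂ < θ_av`
   (the node text's `θ_av^{2(K−k)}` is `θ₂ = θ_av²`), which nothing here or in print provides; `mixedDiff_eq_zero_of_avoids`
   / `…'`: the mixed difference VANISHES when the walk avoids the `n`-step influence set (`T4AvgSensitivity.infl`) of the
   sources of `Λ` (or of `Λ′`) — pair couplings live on pairs of components BOTH influencing the loop, i.e. inside the tube of
   `C`; `LoopPairOscBound.updateFinset`: the fibrewise (rectangle-of-updates) form.
§5 CONSUMER `fibreIntegral_union_loopDressing_sandwich` (WHERE NE1 (ii) IS SPENT): under `LoopPairOscBound av dom C₂ θ₂`,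
   for densities SUPPORTED IN THE DOMAIN (`oldᵢ U ≠ 0 → U ∈ dom j` — the small-field characteristic functions (1.101)) and a
   base point `V ∈ dom j`, the §3 sandwich holds for `F = loopDressing av j n x w` with `δ = C₂·|w|·|Λ₁|·|Λ₂|·θ₂^n`.
§6 (v2, APPEND-ONLY) SEPARATION: `rectangle_iterFrom` — a rectangle of configurations over bond sets `Λ, Λ′` with
   sources in site sets `S, S′` is carried by `n′` averaging steps to a rectangle over the influence sets `infl S n′`,
   `infl S′ n′` (four instances of `T4AvgSensitivity.iterFrom_agreeOff`): while these are disjoint the components "have not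
   met"; the hypothesis shape `LoopPairOscBoundSep av dom C₂ θ₁ θₓ` (NOT PRINTED) — the mixed difference is at most
   `C₂·|w|·|Λ|·|Λ′|·θ₁ⁿ·θₓ^{n′}` for every `n′ ≤ n` with `infl S n′ ∩ infl S′ n′ = ∅` (a first-order rate over all levels
   times a gain `θₓ` per level of SEPARATION); `.of_pair` (`θₓ = 1` = the uniform shape with rate `θ₁`), `.apply_zero`,
   `.of_uniform` (a uniform rate `θ₂ ≤ θ₁θₓ` gives it), `.anti`, `loopPairOscBoundSep_of_loopOscBound` (NE1a ⇒
   `(2C_W, θ, 1)`), `loopPairOscBoundSep_four_one_one` (trivial `(4, 1, 1)`), `.updateFinset`; consumer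
   `fibreIntegral_union_loopDressing_sandwich_sep` (the §3 sandwich with `δ = C₂·|w|·|Λ₁|·|Λ₂|·θ₁ⁿ·θₓ^{n′}` for components
   not met by level `j + n′`).  WHY (cell record `t4/T4-EST-O3Eii.md` v1.2 §3.5 (F7), [analysis], not a kernel fact): in
   the non-abelian model ONE averaging step (15) responds to two bond changes read by a common contour with a mixed term of
   FIRST-order size (commutators), so a UNIFORM pair rate `θ₂ < θ₁` is not expected, while components first read
   together at level `k + n′` should couple with strength `≍ θ₁^{n+n′}` (`θₓ = θ₁`); the abelian linearised model is
   exactly linear at the level of the averaged field and has the uniform rate `θ₂ = θ₁²` (cell seat b07-g5, GAPS C-b07g5-4).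
   The size-weighted sibling of the uniform shape is `T4AvgDerivBound.LoopPairDerivBound` (row T4-O3c.E2, another seat).
The `p`-component case is the iteration of §3 with `(Λ₁ ∪ ⋯ ∪ Λ_{q−1}, Λ_q)`, `q = 2, …, p` (the shape of §4 is linear in
`|Λ|`, so the accumulated remainder is `|t|·C₂|w|θ₂^n·Σ_{i<i′}|Λᵢ||Λ_{i′}|`); it is written out in `t4/T4-EST-O3Eii.md` §3
and NOT kernel-checked here (v1 = two components).

Located items NOT touched (cell records `t4/T4-EST-O3Eii.md` §2, §5): the RATE `θ₂ < θ_av` (NE1 (ii) proper) and the sizes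
of the D-terms themselves (node O3b (i), row T4-O3.E-i — a different seat's module); the complex-analytic (norm ‖·‖_k)
versions of every statement here (T4-XREAD-O3X2 (L5): the printed method bounds analytic extensions, this module is
real/positive); the survival of the coupling remainders through the later T/R steps and the B13/B16 weighted-norm loci
(T4-XREAD-O3X2 rows 9, 14–17; obligations (A), (B) there) — paper-level only, in the EST file; positivity of the pieces
(real fields) is used throughout, as in `T4DressedR` (L5).  LOCATED ROLE (cell record `t4/T4-REF-O3.md` V3/V5, binding on
this row; XREAD C-b07g5-3 (N2)): the remainder size `δ = C₂·|w|·|Λ₁|·|Λ₂|·θ₂^n` of §5 is a ONE-STEP / `μ`-RADIUS quantity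
— it is what keeps `log N₁₂`, the D-terms and `R₁₂` analytic and small in `|t|` at the birth step — and NOT the size that
B13 §2 consumes along the tube of `C` across scales (the budget (TOB-k) of T4-REF-O3 V2 (c)): by V3 any sup-over-fibre size
of a dressed term fails (TOB-k) by a factor `L^{2(K−k)}` per scale, and by V5 (iii) the pair class of this module is booked
across scales with MOMENT-type strengths under the conditions `L⁴θ₁² ≤ 1`, `L⁴θ₁φ ≤ 1` — the located requirement NE1′,
which this module does not touch.  Imports `T4OscSandwich` (hence `T4DressedR`, `T4AvgSensitivity`,
`B15.BasicStep`); Mathlib otherwise; no `sorry`/`axiom`.  Unit `b2b-balaban-pv18` gen 3 (journal CLAIM T4-O3.E-ii);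
records GAPS C-pv18g3-1 / G-pv18g3-1; v1 p179543 (commit fb2e82705e56), cross-read XREAD ok by unit `b2b-balaban-b07-g5`
(GAPS C-b07g5-3, 0 objections); v1.1 p179902 (commit 5207c2bf8a53) = DOCFIX of this module docstring only (notes
N1/N2 of that cross-read; N3 = the cell records, since written) — no declaration changed; v2 = APPEND-ONLY §6 (separation:
`rectangle_iterFrom`, `LoopPairOscBoundSep` + lemmas + consumer; GAPS G-pv18g3-2) — no v1 declaration, statement or proof
changed.
-/

open scoped BigOperators ENNReal
open _root_.MeasureTheory Function Finset

namespace Literature.MathematicalPhysics.QuantumFieldTheory.Balaban1983to89.T4JointDressing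

open B15.BasicStep T4DressedR T4Continuum T4AvgSensitivity T4OscSandwich

/-! ## §0 Two disjoint coordinate updates commute -/

/-- Updating a function on two DISJOINT finite sets of coordinates can be done in either order. [folklore] -/
theorem updateFinset_updateFinset_comm {ι : Type*} [DecidableEq ι] {π : ι → Type*} {s t : Finset ι}
    (hst : Disjoint s t) (x : ∀ i, π i) (y : ∀ i : s, π i) (z : ∀ i : t, π i) :
    updateFinset (updateFinset x s y) t z = updateFinset (updateFinset x t z) s y := by
  funext i
  by_cases hs : i ∈ s <;> by_cases ht : i ∈ t
  · exact (Finset.disjoint_left.mp hst hs ht).elim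
  · simp only [updateFinset, dif_pos hs, dif_neg ht]
  · simp only [updateFinset, dif_neg hs, dif_pos ht]
  · simp only [updateFinset, dif_neg hs, dif_neg ht]

section SetupLevel

variable {P : Params} {j : ℕ} {G : Type*} [GaugeGroup G] [MeasurableSpace G] [HaarData G]
variable [DecidableEq (PBond P j)]

/-! ## §1 Two-fibre comparison: an integral over the JOINT fibre `s₁ ∪ s₂` against the product of two fibre integrals -/

/-- TWO-FIBRE SANDWICH (Fubini over the joint fibre `∫dV⌈_{Λ₁∪Λ₂}` = iterated `∫dV⌈_{Λ₁}∫dV⌈_{Λ₂}`, then pointwise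
comparison): if on the joint fibre through `V`, in iterated coordinates `V←y←z`, the integrand `g` is squeezed between
`cₗ·a(V←y)·b(V←z)` and `cᵤ·a(V←y)·b(V←z)` (`a, b ≥ 0` bounded), then
`cₗ·∫⌈_{Λ₁}a(V)·∫⌈_{Λ₂}b(V) ≤ ∫⌈_{Λ₁∪Λ₂}g(V) ≤ cᵤ·∫⌈_{Λ₁}a(V)·∫⌈_{Λ₂}b(V)`. [folklore] -/
theorem fibreIntegral_union_sandwich {s₁ s₂ : Finset (PBond P j)} (hd : Disjoint s₁ s₂) {g a b : Density P j G}
    (hg : Measurable g) (ha0 : ∀ U, 0 ≤ a U) {A B : ℝ} (haA : ∀ U, a U ≤ A) (hbB : ∀ U, b U ≤ B)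
    (V : GaugeField P j G) {cl cu : ℝ} (hcl : 0 ≤ cl) (hcu : 0 ≤ cu)
    (hlo : ∀ (y : s₁ → G) (z : s₂ → G),
      cl * (a (updateFinset V s₁ y) * b (updateFinset V s₂ z)) ≤ g (updateFinset (updateFinset V s₁ y) s₂ z))
    (hhi : ∀ (y : s₁ → G) (z : s₂ → G),
      g (updateFinset (updateFinset V s₁ y) s₂ z) ≤ cu * (a (updateFinset V s₁ y) * b (updateFinset V s₂ z))) :
    cl * (fibreIntegral s₁ a V * fibreIntegral s₂ b V) ≤ fibreIntegral (s₁ ∪ s₂) g V ∧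
    fibreIntegral (s₁ ∪ s₂) g V ≤ cu * (fibreIntegral s₁ a V * fibreIntegral s₂ b V) := by
  set μH : PBond P j → Measure G := fun _ => (HaarData.haar : Measure G) with hμH
  set La := (∫⋯∫⁻_s₁, (fun U => ENNReal.ofReal (a U)) ∂μH) V with hLa
  set Lb := (∫⋯∫⁻_s₂, (fun U => ENNReal.ofReal (b U)) ∂μH) V with hLb
  set Lg := (∫⋯∫⁻_(s₁ ∪ s₂), (fun U => ENNReal.ofReal (g U)) ∂μH) V with hLg
  -- unfolded (iterated) forms
  have hLa' : La = ∫⁻ y : (s₁ → G), ENNReal.ofReal (a (updateFinset V s₁ y))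
      ∂Measure.pi (fun _ : s₁ => (HaarData.haar : Measure G)) := rfl
  have hLb' : Lb = ∫⁻ z : (s₂ → G), ENNReal.ofReal (b (updateFinset V s₂ z))
      ∂Measure.pi (fun _ : s₂ => (HaarData.haar : Measure G)) := rfl
  have hLg' : Lg = ∫⁻ y : (s₁ → G), ∫⁻ z : (s₂ → G), ENNReal.ofReal (g (updateFinset (updateFinset V s₁ y) s₂ z))
      ∂Measure.pi (fun _ : s₂ => (HaarData.haar : Measure G)) ∂Measure.pi (fun _ : s₁ => (HaarData.haar : Measure G)) := by
    have hu := congrFun (lmarginal_union μH (fun U => ENNReal.ofReal (g U)) (ofReal_comp_measurable hg) hd) V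
    exact hu.trans rfl
  -- finiteness of the two factors
  have hLa_top : La ≠ ∞ := ne_top_of_le_ne_top ENNReal.ofReal_ne_top (lmarginal_ofReal_le s₁ haA V)
  have hLb_top : Lb ≠ ∞ := ne_top_of_le_ne_top ENNReal.ofReal_ne_top (lmarginal_ofReal_le s₂ hbB V)
  -- upper comparison in `ℝ≥0∞`
  have hup : Lg ≤ ENNReal.ofReal cu * La * Lb := by
    rw [hLg', hLa', hLb']
    calc ∫⁻ y : (s₁ → G), ∫⁻ z : (s₂ → G), ENNReal.ofReal (g (updateFinset (updateFinset V s₁ y) s₂ z))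
          ∂Measure.pi (fun _ : s₂ => (HaarData.haar : Measure G)) ∂Measure.pi (fun _ : s₁ => (HaarData.haar : Measure G))
        ≤ ∫⁻ y : (s₁ → G), ∫⁻ z : (s₂ → G),
            ENNReal.ofReal cu * ENNReal.ofReal (a (updateFinset V s₁ y)) * ENNReal.ofReal (b (updateFinset V s₂ z))
          ∂Measure.pi (fun _ : s₂ => (HaarData.haar : Measure G)) ∂Measure.pi (fun _ : s₁ => (HaarData.haar : Measure G)) := by
          refine lintegral_mono (fun y => lintegral_mono (fun z => ?_))
          rw [← ENNReal.ofReal_mul hcu, ← ENNReal.ofReal_mul (mul_nonneg hcu (ha0 _)), mul_assoc]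
          exact ENNReal.ofReal_le_ofReal (hhi y z)
      _ = ∫⁻ y : (s₁ → G), ENNReal.ofReal cu * ENNReal.ofReal (a (updateFinset V s₁ y)) *
            ∫⁻ z : (s₂ → G), ENNReal.ofReal (b (updateFinset V s₂ z))
          ∂Measure.pi (fun _ : s₂ => (HaarData.haar : Measure G)) ∂Measure.pi (fun _ : s₁ => (HaarData.haar : Measure G)) := by
          refine lintegral_congr (fun y => ?_)
          rw [lintegral_const_mul' _ _ (ENNReal.mul_ne_top ENNReal.ofReal_ne_top ENNReal.ofReal_ne_top)]
      _ = (∫⁻ y : (s₁ → G), ENNReal.ofReal cu * ENNReal.ofReal (a (updateFinset V s₁ y))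
          ∂Measure.pi (fun _ : s₁ => (HaarData.haar : Measure G))) *
            ∫⁻ z : (s₂ → G), ENNReal.ofReal (b (updateFinset V s₂ z))
          ∂Measure.pi (fun _ : s₂ => (HaarData.haar : Measure G)) := by
          rw [lintegral_mul_const' _ _ (by rw [← hLb']; exact hLb_top)]
      _ = ENNReal.ofReal cu * (∫⁻ y : (s₁ → G), ENNReal.ofReal (a (updateFinset V s₁ y))
          ∂Measure.pi (fun _ : s₁ => (HaarData.haar : Measure G))) *
            ∫⁻ z : (s₂ → G), ENNReal.ofReal (b (updateFinset V s₂ z))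
          ∂Measure.pi (fun _ : s₂ => (HaarData.haar : Measure G)) := by
          rw [lintegral_const_mul' _ _ ENNReal.ofReal_ne_top]
  -- lower comparison in `ℝ≥0∞`
  have hlow : ENNReal.ofReal cl * La * Lb ≤ Lg := by
    rw [hLg', hLa', hLb']
    calc ENNReal.ofReal cl * (∫⁻ y : (s₁ → G), ENNReal.ofReal (a (updateFinset V s₁ y))
          ∂Measure.pi (fun _ : s₁ => (HaarData.haar : Measure G))) *
            ∫⁻ z : (s₂ → G), ENNReal.ofReal (b (updateFinset V s₂ z))
          ∂Measure.pi (fun _ : s₂ => (HaarData.haar : Measure G))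
        = (∫⁻ y : (s₁ → G), ENNReal.ofReal cl * ENNReal.ofReal (a (updateFinset V s₁ y))
          ∂Measure.pi (fun _ : s₁ => (HaarData.haar : Measure G))) *
            ∫⁻ z : (s₂ → G), ENNReal.ofReal (b (updateFinset V s₂ z))
          ∂Measure.pi (fun _ : s₂ => (HaarData.haar : Measure G)) := by
          rw [lintegral_const_mul' _ _ ENNReal.ofReal_ne_top]
      _ = ∫⁻ y : (s₁ → G), ENNReal.ofReal cl * ENNReal.ofReal (a (updateFinset V s₁ y)) *
            ∫⁻ z : (s₂ → G), ENNReal.ofReal (b (updateFinset V s₂ z))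
          ∂Measure.pi (fun _ : s₂ => (HaarData.haar : Measure G)) ∂Measure.pi (fun _ : s₁ => (HaarData.haar : Measure G)) := by
          rw [lintegral_mul_const' _ _ (by rw [← hLb']; exact hLb_top)]
      _ = ∫⁻ y : (s₁ → G), ∫⁻ z : (s₂ → G),
            ENNReal.ofReal cl * ENNReal.ofReal (a (updateFinset V s₁ y)) * ENNReal.ofReal (b (updateFinset V s₂ z))
          ∂Measure.pi (fun _ : s₂ => (HaarData.haar : Measure G)) ∂Measure.pi (fun _ : s₁ => (HaarData.haar : Measure G)) := by
          refine lintegral_congr (fun y => ?_)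
          rw [lintegral_const_mul' _ _ (ENNReal.mul_ne_top ENNReal.ofReal_ne_top ENNReal.ofReal_ne_top)]
      _ ≤ ∫⁻ y : (s₁ → G), ∫⁻ z : (s₂ → G), ENNReal.ofReal (g (updateFinset (updateFinset V s₁ y) s₂ z))
          ∂Measure.pi (fun _ : s₂ => (HaarData.haar : Measure G)) ∂Measure.pi (fun _ : s₁ => (HaarData.haar : Measure G)) := by
          refine lintegral_mono (fun y => lintegral_mono (fun z => ?_))
          rw [← ENNReal.ofReal_mul hcl, ← ENNReal.ofReal_mul (mul_nonneg hcl (ha0 _)), mul_assoc]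
          exact ENNReal.ofReal_le_ofReal (hlo y z)
  have hR_top : ENNReal.ofReal cu * La * Lb ≠ ∞ :=
    ENNReal.mul_ne_top (ENNReal.mul_ne_top ENNReal.ofReal_ne_top hLa_top) hLb_top
  have hLg_top : Lg ≠ ∞ := ne_top_of_le_ne_top hR_top hup
  -- back to real numbers
  have e1 : fibreIntegral (s₁ ∪ s₂) g V = Lg.toReal := by simp only [fibreIntegral]; rw [← hμH]
  have e2 : fibreIntegral s₁ a V = La.toReal := by simp only [fibreIntegral]; rw [← hμH]
  have e3 : fibreIntegral s₂ b V = Lb.toReal := by simp only [fibreIntegral]; rw [← hμH]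
  rw [e1, e2, e3]
  constructor
  · have := ENNReal.toReal_mono hLg_top hlow
    rwa [ENNReal.toReal_mul, ENNReal.toReal_mul, ENNReal.toReal_ofReal hcl, mul_assoc] at this
  · have := ENNReal.toReal_mono hR_top hup
    rwa [ENNReal.toReal_mul, ENNReal.toReal_mul, ENNReal.toReal_ofReal hcu, mul_assoc] at this

/-! ## §2 The printed factorisation as a theorem: joint normalisation over `Λ₁ ∪ Λ₂` = product `∏ᵢ` for factorised data -/

/-- EXACT FACTORISATION over two disjoint fibres — the kernel form of "The integrations in (1.99) are also factorized in
those components" (p. 201) and of [II] p. 378 "We use the fact that these integrations factorize in components of Z":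
if `f₁` does not depend on the `Λ₂`-variables and `f₂` not on the `Λ₁`-variables (both measurable and bounded above,
`0 ≤ f₁`), then `∫dV⌈_{Λ₁∪Λ₂}(f₁·f₂) = ∫dV⌈_{Λ₁}f₁ · ∫dV⌈_{Λ₂}f₂` pointwise. [cite: Balaban1989LargeFieldI, p.201 l.13] -/
theorem fibreIntegral_union_mul_eq {s₁ s₂ : Finset (PBond P j)} (hd : Disjoint s₁ s₂) {f₁ f₂ : Density P j G}
    (hm₁ : Measurable f₁) (hm₂ : Measurable f₂) (h0₁ : ∀ U, 0 ≤ f₁ U)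
    {C₁ C₂ : ℝ} (hC₁ : ∀ U, f₁ U ≤ C₁) (hC₂ : ∀ U, f₂ U ≤ C₂) (hI₁ : FibreIndep s₂ f₁) (hI₂ : FibreIndep s₁ f₂)
    (V : GaugeField P j G) :
    fibreIntegral (s₁ ∪ s₂) (fun U => f₁ U * f₂ U) V = fibreIntegral s₁ f₁ V * fibreIntegral s₂ f₂ V := by
  have hpt : ∀ (y : s₁ → G) (z : s₂ → G), f₁ (updateFinset (updateFinset V s₁ y) s₂ z) * f₂ (updateFinset (updateFinset V s₁ y) s₂ z)
      = f₁ (updateFinset V s₁ y) * f₂ (updateFinset V s₂ z) := by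
    intro y z
    rw [hI₁ (updateFinset V s₁ y) z, updateFinset_updateFinset_comm hd V y z, hI₂ (updateFinset V s₂ z) y]
  have h := fibreIntegral_union_sandwich hd (g := fun U => f₁ U * f₂ U) (hm₁.mul hm₂) h0₁ hC₁ hC₂ V zero_le_one zero_le_one
    (fun y z => by rw [hpt y z, one_mul]) (fun y z => by rw [hpt y z, one_mul])
  simp only [one_mul] at h
  exact le_antisymm h.2 h.1

/-- THE PRODUCT FORMULA (1.100) IS THE JOINT NORMALISATION for factorised data: for a term whose insert `ρ(Z″,·) = ins₁·ins₂`
and integrated density `ρ(Z,·) = old₁·old₂` factorise over two components with disjoint integration domains `Λ₁`, `Λ₂`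
(the `i`-th factors independent of the other component's variables), ONE normalisation over `Λ₁ ∪ Λ₂` (convention (β) of
the cell, T4-DAG v2 §1 D5 / §2 O3b (ii)) equals the product `∏_{i=1,2}` of the per-component normalised factors of (1.100):
`ins₁ins₂(V)·∫⌈_{Λ₁∪Λ₂}(old₁old₂)/∫⌈_{Λ₁∪Λ₂}(ins₁ins₂) = [ins₁(V)∫⌈_{Λ₁}old₁/∫⌈_{Λ₁}ins₁]·[ins₂(V)∫⌈_{Λ₂}old₂/∫⌈_{Λ₂}ins₂]`.
[cite: Balaban1989LargeFieldI, (1.100) p.201] -/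
theorem normTerm_union_mul_eq {s₁ s₂ : Finset (PBond P j)} (hd : Disjoint s₁ s₂) {ins₁ ins₂ old₁ old₂ : Density P j G}
    (hmi₁ : Measurable ins₁) (hmi₂ : Measurable ins₂) (hmo₁ : Measurable old₁) (hmo₂ : Measurable old₂)
    (h0i₁ : ∀ U, 0 ≤ ins₁ U) (h0o₁ : ∀ U, 0 ≤ old₁ U)
    {C : ℝ} (hCi₁ : ∀ U, ins₁ U ≤ C) (hCi₂ : ∀ U, ins₂ U ≤ C) (hCo₁ : ∀ U, old₁ U ≤ C) (hCo₂ : ∀ U, old₂ U ≤ C)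
    (hIi₁ : FibreIndep s₂ ins₁) (hIi₂ : FibreIndep s₁ ins₂) (hIo₁ : FibreIndep s₂ old₁) (hIo₂ : FibreIndep s₁ old₂)
    (V : GaugeField P j G) :
    normTerm (s₁ ∪ s₂) (fun U => ins₁ U * ins₂ U) (fun U => old₁ U * old₂ U) V
      = normTerm s₁ ins₁ old₁ V * normTerm s₂ ins₂ old₂ V := by
  simp only [normTerm]
  rw [fibreIntegral_union_mul_eq hd hmo₁ hmo₂ h0o₁ hCo₁ hCo₂ hIo₁ hIo₂ V,
    fibreIntegral_union_mul_eq hd hmi₁ hmi₂ h0i₁ hCi₁ hCi₂ hIi₁ hIi₂ V, mul_div_mul_comm]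
  ring

/-- … AND IT SURVIVES ANY DRESSING THAT FACTORISES OVER THE COMPONENTS: with `w = w₁·w₂`, `wᵢ ≥ 0` bounded and independent of
the other component's variables, the (α)-dressed joint term (`T4DressedR.RopRealIn`: dressing inside the integrated factor)
is the product of the per-component dressed terms.  Hence ALL inter-component coupling of a dressed term comes from the
NON-MULTIPLICATIVITY of the dressing across the components (for `w = e^{tF}`: the non-additivity of `F`, §3). [folklore] -/
theorem normTerm_union_dressed_of_mul {s₁ s₂ : Finset (PBond P j)} (hd : Disjoint s₁ s₂)
    {ins₁ ins₂ old₁ old₂ w₁ w₂ : Density P j G}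
    (hmi₁ : Measurable ins₁) (hmi₂ : Measurable ins₂) (hmo₁ : Measurable old₁) (hmo₂ : Measurable old₂)
    (hmw₁ : Measurable w₁) (hmw₂ : Measurable w₂)
    (h0i₁ : ∀ U, 0 ≤ ins₁ U) (h0o₁ : ∀ U, 0 ≤ old₁ U) (h0w₁ : ∀ U, 0 ≤ w₁ U) (h0w₂ : ∀ U, 0 ≤ w₂ U)
    {C : ℝ} (hCi₁ : ∀ U, ins₁ U ≤ C) (hCi₂ : ∀ U, ins₂ U ≤ C) (hCo₁ : ∀ U, old₁ U ≤ C) (hCo₂ : ∀ U, old₂ U ≤ C)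
    {M : ℝ} (hM₁ : ∀ U, w₁ U ≤ M) (hM₂ : ∀ U, w₂ U ≤ M)
    (hIi₁ : FibreIndep s₂ ins₁) (hIi₂ : FibreIndep s₁ ins₂) (hIo₁ : FibreIndep s₂ old₁) (hIo₂ : FibreIndep s₁ old₂)
    (hIw₁ : FibreIndep s₂ w₁) (hIw₂ : FibreIndep s₁ w₂) (V : GaugeField P j G) :
    normTerm (s₁ ∪ s₂) (fun U => ins₁ U * ins₂ U) (fun U => old₁ U * old₂ U * (w₁ U * w₂ U)) V
      = normTerm s₁ ins₁ (fun U => old₁ U * w₁ U) V * normTerm s₂ ins₂ (fun U => old₂ U * w₂ U) V := by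
  have hC0 : 0 ≤ C := le_trans (h0i₁ V) (hCi₁ V)
  have e : (fun U => old₁ U * old₂ U * (w₁ U * w₂ U)) = fun U => (old₁ U * w₁ U) * (old₂ U * w₂ U) := by
    funext U; ring
  rw [e]
  exact normTerm_union_mul_eq hd (old₁ := fun U => old₁ U * w₁ U) (old₂ := fun U => old₂ U * w₂ U)
    hmi₁ hmi₂ (hmo₁.mul hmw₁) (hmo₂.mul hmw₂) h0i₁
    (fun U => mul_nonneg (h0o₁ U) (h0w₁ U)) (C := max C (C * M))
    (fun U => (hCi₁ U).trans (le_max_left _ _)) (fun U => (hCi₂ U).trans (le_max_left _ _))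
    (fun U => (mul_le_mul (hCo₁ U) (hM₁ U) (h0w₁ U) hC0).trans (le_max_right _ _))
    (fun U => (mul_le_mul (hCo₂ U) (hM₂ U) (h0w₂ U) hC0).trans (le_max_right _ _))
    hIi₁ hIi₂
    (fun x y => show old₁ (updateFinset x s₂ y) * w₁ (updateFinset x s₂ y) = old₁ x * w₁ x by rw [hIo₁ x y, hIw₁ x y])
    (fun x y => show old₂ (updateFinset x s₁ y) * w₂ (updateFinset x s₁ y) = old₂ x * w₂ x by rw [hIo₂ x y, hIw₂ x y]) V

/-! ## §3 Non-factorising exponential dressing `w = e^{tF}`: the two-body coupling remainder ("crude Mayer step") -/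

omit [GaugeGroup G] [MeasurableSpace G] [HaarData G] [DecidableEq (PBond P j)] in
/-- If the MIXED DIFFERENCE `m = x₁₂ − x₁ − x₂ + x₀` is at most `δ` in absolute value, then
`e^{−|t|δ}·e^{−t x₀}·(e^{t x₁}e^{t x₂}) ≤ e^{t x₁₂} ≤ e^{|t|δ}·e^{−t x₀}·(e^{t x₁}e^{t x₂})`. [folklore] -/
theorem exp_mixed_bounds {x₁₂ x₁ x₂ x₀ t δ : ℝ} (h : |x₁₂ - x₁ - x₂ + x₀| ≤ δ) :
    Real.exp (-(|t| * δ)) * Real.exp (-(t * x₀)) * (Real.exp (t * x₁) * Real.exp (t * x₂)) ≤ Real.exp (t * x₁₂) ∧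
    Real.exp (t * x₁₂) ≤ Real.exp (|t| * δ) * Real.exp (-(t * x₀)) * (Real.exp (t * x₁) * Real.exp (t * x₂)) := by
  have h1 : |t * (x₁₂ - x₁ - x₂ + x₀)| ≤ |t| * δ := by
    rw [abs_mul]; exact mul_le_mul_of_nonneg_left h (abs_nonneg t)
  have h2 := neg_abs_le (t * (x₁₂ - x₁ - x₂ + x₀))
  have h3 := le_abs_self (t * (x₁₂ - x₁ - x₂ + x₀))
  have eL : Real.exp (-(|t| * δ)) * Real.exp (-(t * x₀)) * (Real.exp (t * x₁) * Real.exp (t * x₂))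
      = Real.exp (-(|t| * δ) + -(t * x₀) + (t * x₁ + t * x₂)) := by simp only [← Real.exp_add]
  have eU : Real.exp (|t| * δ) * Real.exp (-(t * x₀)) * (Real.exp (t * x₁) * Real.exp (t * x₂))
      = Real.exp (|t| * δ + -(t * x₀) + (t * x₁ + t * x₂)) := by simp only [← Real.exp_add]
  rw [eL, eU, Real.exp_le_exp, Real.exp_le_exp]
  constructor <;> linarith [h1, h2, h3]

/-- TWO-BODY COUPLING SANDWICH (the crude Mayer step as a theorem).  Data: two disjoint integration domains `Λ₁, Λ₂` of ONE
term; integrated densities `old₁` (independent of the `Λ₂`-variables), `old₂` (independent of the `Λ₁`-variables),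
measurable, `0 ≤ oldᵢ ≤ C`; a measurable bounded exponent `F` (`|F| ≤ B`; the cell's `F = W_C∘avg^{K−k}`); and a bound `δ` on
the MIXED SECOND DIFFERENCE of `F` across the two components on the joint fibre through `V` (only where the densities are
non-zero): `|F(V←y←z) − F(V←y) − F(V←z) + F(V)| ≤ δ`.  Conclusion, with `Nᵢ := ∫dV⌈_{Λᵢ}(oldᵢ·e^{tF})(V)` and
`N₁₂ := ∫dV⌈_{Λ₁∪Λ₂}(old₁old₂·e^{tF})(V)`:  `e^{−|t|δ}e^{−tF(V)}·N₁N₂ ≤ N₁₂ ≤ e^{|t|δ}e^{−tF(V)}·N₁N₂` — the jointly dressed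
fluctuation integral factorises over the components up to `e^{±|t|δ}` (`δ = 0` for an additive `F = F₁ + F₂`, where §2
applies exactly). [folklore] -/
theorem fibreIntegral_union_exp_sandwich {s₁ s₂ : Finset (PBond P j)} (hd : Disjoint s₁ s₂) {old₁ old₂ : Density P j G}
    (F : Density P j G) (hm₁ : Measurable old₁) (hm₂ : Measurable old₂) (hF : Measurable F)
    (h0₁ : ∀ U, 0 ≤ old₁ U) (h0₂ : ∀ U, 0 ≤ old₂ U) {C : ℝ} (hC₁ : ∀ U, old₁ U ≤ C) (hC₂ : ∀ U, old₂ U ≤ C)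
    (hI₁ : FibreIndep s₂ old₁) (hI₂ : FibreIndep s₁ old₂) {B : ℝ} (hFB : ∀ U, |F U| ≤ B) (t δ : ℝ) (V : GaugeField P j G)
    (hmix : ∀ (y : s₁ → G) (z : s₂ → G), old₁ (updateFinset V s₁ y) ≠ 0 → old₂ (updateFinset V s₂ z) ≠ 0 →
      |F (updateFinset (updateFinset V s₁ y) s₂ z) - F (updateFinset V s₁ y) - F (updateFinset V s₂ z) + F V| ≤ δ) :
    Real.exp (-(|t| * δ)) * Real.exp (-(t * F V)) *
        (fibreIntegral s₁ (fun U => old₁ U * Real.exp (t * F U)) V * fibreIntegral s₂ (fun U => old₂ U * Real.exp (t * F U)) V)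
      ≤ fibreIntegral (s₁ ∪ s₂) (fun U => old₁ U * old₂ U * Real.exp (t * F U)) V ∧
    fibreIntegral (s₁ ∪ s₂) (fun U => old₁ U * old₂ U * Real.exp (t * F U)) V
      ≤ Real.exp (|t| * δ) * Real.exp (-(t * F V)) *
        (fibreIntegral s₁ (fun U => old₁ U * Real.exp (t * F U)) V * fibreIntegral s₂ (fun U => old₂ U * Real.exp (t * F U)) V) := by
  have hC0 : 0 ≤ C := le_trans (h0₁ V) (hC₁ V)
  have hexpB : ∀ U, Real.exp (t * F U) ≤ Real.exp (|t| * B) := fun U => by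
    rw [Real.exp_le_exp]
    calc t * F U ≤ |t * F U| := le_abs_self _
      _ = |t| * |F U| := abs_mul _ _
      _ ≤ |t| * B := mul_le_mul_of_nonneg_left (hFB U) (abs_nonneg t)
  have hbd : ∀ {old : Density P j G}, (∀ U, 0 ≤ old U) → (∀ U, old U ≤ C) →
      ∀ U, old U * Real.exp (t * F U) ≤ C * Real.exp (|t| * B) := fun _ hC U =>
    mul_le_mul (hC U) (hexpB U) (Real.exp_pos _).le hC0
  -- the pointwise identity on the joint fibre
  have hpt : ∀ (y : s₁ → G) (z : s₂ → G),
      old₁ (updateFinset (updateFinset V s₁ y) s₂ z) = old₁ (updateFinset V s₁ y) ∧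
      old₂ (updateFinset (updateFinset V s₁ y) s₂ z) = old₂ (updateFinset V s₂ z) := by
    intro y z
    refine ⟨hI₁ (updateFinset V s₁ y) z, ?_⟩
    rw [updateFinset_updateFinset_comm hd V y z, hI₂ (updateFinset V s₂ z) y]
  refine fibreIntegral_union_sandwich hd (g := fun U => old₁ U * old₂ U * Real.exp (t * F U))
    (a := fun U => old₁ U * Real.exp (t * F U)) (b := fun U => old₂ U * Real.exp (t * F U))
    ((hm₁.mul hm₂).mul (Real.measurable_exp.comp (hF.const_mul t)))
    (fun U => mul_nonneg (h0₁ U) (Real.exp_pos _).le) (hbd h0₁ hC₁) (hbd h0₂ hC₂) V (by positivity) (by positivity)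
    (fun y z => ?_) (fun y z => ?_)
  · -- lower
    show Real.exp (-(|t| * δ)) * Real.exp (-(t * F V)) *
        (old₁ (updateFinset V s₁ y) * Real.exp (t * F (updateFinset V s₁ y)) *
          (old₂ (updateFinset V s₂ z) * Real.exp (t * F (updateFinset V s₂ z))))
      ≤ old₁ (updateFinset (updateFinset V s₁ y) s₂ z) * old₂ (updateFinset (updateFinset V s₁ y) s₂ z) *
          Real.exp (t * F (updateFinset (updateFinset V s₁ y) s₂ z))
    rw [(hpt y z).1, (hpt y z).2]
    by_cases h1 : old₁ (updateFinset V s₁ y) = 0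
    · rw [h1]; simp
    by_cases h2 : old₂ (updateFinset V s₂ z) = 0
    · rw [h2]; simp
    have hb := (exp_mixed_bounds (t := t) (hmix y z h1 h2)).1
    have hoo : 0 ≤ old₁ (updateFinset V s₁ y) * old₂ (updateFinset V s₂ z) := mul_nonneg (h0₁ _) (h0₂ _)
    calc Real.exp (-(|t| * δ)) * Real.exp (-(t * F V)) *
          (old₁ (updateFinset V s₁ y) * Real.exp (t * F (updateFinset V s₁ y)) *
            (old₂ (updateFinset V s₂ z) * Real.exp (t * F (updateFinset V s₂ z))))
        = old₁ (updateFinset V s₁ y) * old₂ (updateFinset V s₂ z) *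
            (Real.exp (-(|t| * δ)) * Real.exp (-(t * F V)) *
              (Real.exp (t * F (updateFinset V s₁ y)) * Real.exp (t * F (updateFinset V s₂ z)))) := by ring
      _ ≤ old₁ (updateFinset V s₁ y) * old₂ (updateFinset V s₂ z) *
            Real.exp (t * F (updateFinset (updateFinset V s₁ y) s₂ z)) := mul_le_mul_of_nonneg_left hb hoo
  · -- upper
    show old₁ (updateFinset (updateFinset V s₁ y) s₂ z) * old₂ (updateFinset (updateFinset V s₁ y) s₂ z) *
          Real.exp (t * F (updateFinset (updateFinset V s₁ y) s₂ z))
      ≤ Real.exp (|t| * δ) * Real.exp (-(t * F V)) *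
        (old₁ (updateFinset V s₁ y) * Real.exp (t * F (updateFinset V s₁ y)) *
          (old₂ (updateFinset V s₂ z) * Real.exp (t * F (updateFinset V s₂ z))))
    rw [(hpt y z).1, (hpt y z).2]
    by_cases h1 : old₁ (updateFinset V s₁ y) = 0
    · rw [h1]; simp
    by_cases h2 : old₂ (updateFinset V s₂ z) = 0
    · rw [h2]; simp
    have hb := (exp_mixed_bounds (t := t) (hmix y z h1 h2)).2
    have hoo : 0 ≤ old₁ (updateFinset V s₁ y) * old₂ (updateFinset V s₂ z) := mul_nonneg (h0₁ _) (h0₂ _)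
    calc old₁ (updateFinset V s₁ y) * old₂ (updateFinset V s₂ z) *
            Real.exp (t * F (updateFinset (updateFinset V s₁ y) s₂ z))
        ≤ old₁ (updateFinset V s₁ y) * old₂ (updateFinset V s₂ z) *
            (Real.exp (|t| * δ) * Real.exp (-(t * F V)) *
              (Real.exp (t * F (updateFinset V s₁ y)) * Real.exp (t * F (updateFinset V s₂ z)))) :=
          mul_le_mul_of_nonneg_left hb hoo
      _ = Real.exp (|t| * δ) * Real.exp (-(t * F V)) *
        (old₁ (updateFinset V s₁ y) * Real.exp (t * F (updateFinset V s₁ y)) *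
          (old₂ (updateFinset V s₂ z) * Real.exp (t * F (updateFinset V s₂ z)))) := by ring

/-- Fibre integrals are non-negative. [folklore] -/
theorem fibreIntegral_nonneg (s : Finset (PBond P j)) (f : Density P j G) (V : GaugeField P j G) :
    0 ≤ fibreIntegral s f V := by
  unfold fibreIntegral; exact ENNReal.toReal_nonneg

/-- A dressed fluctuation integral `∫dV⌈_Λ(old·e^{tF})(V)` is POSITIVE as soon as the undressed one is non-zero
(`|F| ≤ B`, `0 ≤ old ≤ C`): it is at least `e^{−|t|B}·∫dV⌈_Λ old(V)`. [folklore] -/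
theorem fibreIntegral_exp_dressed_pos (s : Finset (PBond P j)) {old : Density P j G} (F : Density P j G)
    (h0 : ∀ U, 0 ≤ old U) {C : ℝ} (hC : ∀ U, old U ≤ C) {B : ℝ} (hFB : ∀ U, |F U| ≤ B) (t : ℝ) (V : GaugeField P j G)
    (hne : fibreIntegral s old V ≠ 0) : 0 < fibreIntegral s (fun U => old U * Real.exp (t * F U)) V := by
  have hI : 0 < fibreIntegral s old V := lt_of_le_of_ne (fibreIntegral_nonneg s old V) (Ne.symm hne)
  have hlow := mul_fibreIntegral_le_at s h0 hC V (w := fun U => Real.exp (t * F U))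
    (Real.exp_pos (-(|t| * B))).le (Real.exp_pos (|t| * B)).le
    (fun y _ => (exp_dressing_bounds hFB t (updateFinset V s y)).1)
    (fun y _ => (exp_dressing_bounds hFB t (updateFinset V s y)).2)
  exact lt_of_lt_of_le (mul_pos (Real.exp_pos _) hI) hlow

/-- LOG FORM — THE TWO-BODY COUPLING DEFECT.  In the setting of `fibreIntegral_union_exp_sandwich`, when the undressed
fluctuation integrals `∫dV⌈_{Λᵢ}oldᵢ(V)` are non-zero (the printed proviso "the denominators are positive", p. 176), the
dressed ones are positive and  `|log N₁₂ − log N₁ − log N₂ + tF(V)| ≤ |t|·δ`.  [folklore] -/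
theorem abs_log_coupling_le {s₁ s₂ : Finset (PBond P j)} (hd : Disjoint s₁ s₂) {old₁ old₂ : Density P j G}
    (F : Density P j G) (hm₁ : Measurable old₁) (hm₂ : Measurable old₂) (hF : Measurable F)
    (h0₁ : ∀ U, 0 ≤ old₁ U) (h0₂ : ∀ U, 0 ≤ old₂ U) {C : ℝ} (hC₁ : ∀ U, old₁ U ≤ C) (hC₂ : ∀ U, old₂ U ≤ C)
    (hI₁ : FibreIndep s₂ old₁) (hI₂ : FibreIndep s₁ old₂) {B : ℝ} (hFB : ∀ U, |F U| ≤ B) (t δ : ℝ) (V : GaugeField P j G)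
    (hmix : ∀ (y : s₁ → G) (z : s₂ → G), old₁ (updateFinset V s₁ y) ≠ 0 → old₂ (updateFinset V s₂ z) ≠ 0 →
      |F (updateFinset (updateFinset V s₁ y) s₂ z) - F (updateFinset V s₁ y) - F (updateFinset V s₂ z) + F V| ≤ δ)
    (hne₁ : fibreIntegral s₁ old₁ V ≠ 0) (hne₂ : fibreIntegral s₂ old₂ V ≠ 0) :
    |Real.log (fibreIntegral (s₁ ∪ s₂) (fun U => old₁ U * old₂ U * Real.exp (t * F U)) V)
      - Real.log (fibreIntegral s₁ (fun U => old₁ U * Real.exp (t * F U)) V)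
      - Real.log (fibreIntegral s₂ (fun U => old₂ U * Real.exp (t * F U)) V) + t * F V| ≤ |t| * δ := by
  have hsw := fibreIntegral_union_exp_sandwich hd F hm₁ hm₂ hF h0₁ h0₂ hC₁ hC₂ hI₁ hI₂ hFB t δ V hmix
  set N₁₂ := fibreIntegral (s₁ ∪ s₂) (fun U => old₁ U * old₂ U * Real.exp (t * F U)) V with hN₁₂
  set N₁ := fibreIntegral s₁ (fun U => old₁ U * Real.exp (t * F U)) V with hN₁
  set N₂ := fibreIntegral s₂ (fun U => old₂ U * Real.exp (t * F U)) V with hN₂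
  have hN₁pos : 0 < N₁ := fibreIntegral_exp_dressed_pos s₁ F h0₁ hC₁ hFB t V hne₁
  have hN₂pos : 0 < N₂ := fibreIntegral_exp_dressed_pos s₂ F h0₂ hC₂ hFB t V hne₂
  have hLpos : 0 < Real.exp (-(|t| * δ)) * Real.exp (-(t * F V)) * (N₁ * N₂) := by positivity
  have hN₁₂pos : 0 < N₁₂ := lt_of_lt_of_le hLpos hsw.1
  have hlogU : Real.log (Real.exp (|t| * δ) * Real.exp (-(t * F V)) * (N₁ * N₂))
      = |t| * δ + -(t * F V) + (Real.log N₁ + Real.log N₂) := by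
    rw [Real.log_mul (by positivity) (by positivity), Real.log_mul (by positivity) (by positivity),
      Real.log_mul hN₁pos.ne' hN₂pos.ne', Real.log_exp, Real.log_exp]
  have hlogL : Real.log (Real.exp (-(|t| * δ)) * Real.exp (-(t * F V)) * (N₁ * N₂))
      = -(|t| * δ) + -(t * F V) + (Real.log N₁ + Real.log N₂) := by
    rw [Real.log_mul (by positivity) (by positivity), Real.log_mul (by positivity) (by positivity),
      Real.log_mul hN₁pos.ne' hN₂pos.ne', Real.log_exp, Real.log_exp]
  have hup := Real.log_le_log hN₁₂pos hsw.2
  have hlow := Real.log_le_log hLpos hsw.1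
  rw [hlogU] at hup
  rw [hlogL] at hlow
  rw [abs_le]
  constructor <;> linarith

/-- … IN D-TERM FORM.  With ANY convention of the type `D_Λ(t;V) := log(∫⌈_Λ(old·e^{tF})(V)/∫⌈_Λ old(V)) − tF(V)`
(the "dressing defect" of T4-DAG v2 §2 O3b (i), base point `V`; the joint term normalised over `Λ₁ ∪ Λ₂` with the undressed
joint fluctuation integral, which FACTORISES by `fibreIntegral_union_mul_eq`):  `D_{Λ₁∪Λ₂} = D_{Λ₁} + D_{Λ₂} + R₁₂`,
`|R₁₂| ≤ |t|·δ` — the crude two-body Mayer step: joint dressed normalisation (β) = product `∏ᵢ` of dressed per-component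
factors × `e^{R₁₂}`. [folklore] -/
theorem abs_defect_union_sub_le {s₁ s₂ : Finset (PBond P j)} (hd : Disjoint s₁ s₂) {old₁ old₂ : Density P j G}
    (F : Density P j G) (hm₁ : Measurable old₁) (hm₂ : Measurable old₂) (hF : Measurable F)
    (h0₁ : ∀ U, 0 ≤ old₁ U) (h0₂ : ∀ U, 0 ≤ old₂ U) {C : ℝ} (hC₁ : ∀ U, old₁ U ≤ C) (hC₂ : ∀ U, old₂ U ≤ C)
    (hI₁ : FibreIndep s₂ old₁) (hI₂ : FibreIndep s₁ old₂) {B : ℝ} (hFB : ∀ U, |F U| ≤ B) (t δ : ℝ) (V : GaugeField P j G)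
    (hmix : ∀ (y : s₁ → G) (z : s₂ → G), old₁ (updateFinset V s₁ y) ≠ 0 → old₂ (updateFinset V s₂ z) ≠ 0 →
      |F (updateFinset (updateFinset V s₁ y) s₂ z) - F (updateFinset V s₁ y) - F (updateFinset V s₂ z) + F V| ≤ δ)
    (hne₁ : fibreIntegral s₁ old₁ V ≠ 0) (hne₂ : fibreIntegral s₂ old₂ V ≠ 0) :
    |(Real.log (fibreIntegral (s₁ ∪ s₂) (fun U => old₁ U * old₂ U * Real.exp (t * F U)) V
          / fibreIntegral (s₁ ∪ s₂) (fun U => old₁ U * old₂ U) V) - t * F V)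
      - (Real.log (fibreIntegral s₁ (fun U => old₁ U * Real.exp (t * F U)) V / fibreIntegral s₁ old₁ V) - t * F V)
      - (Real.log (fibreIntegral s₂ (fun U => old₂ U * Real.exp (t * F U)) V / fibreIntegral s₂ old₂ V) - t * F V)|
      ≤ |t| * δ := by
  have h := abs_log_coupling_le hd F hm₁ hm₂ hF h0₁ h0₂ hC₁ hC₂ hI₁ hI₂ hFB t δ V hmix hne₁ hne₂
  have hN₁pos := fibreIntegral_exp_dressed_pos s₁ F h0₁ hC₁ hFB t V hne₁
  have hN₂pos := fibreIntegral_exp_dressed_pos s₂ F h0₂ hC₂ hFB t V hne₂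
  have hsw := fibreIntegral_union_exp_sandwich hd F hm₁ hm₂ hF h0₁ h0₂ hC₁ hC₂ hI₁ hI₂ hFB t δ V hmix
  have hLpos : 0 < Real.exp (-(|t| * δ)) * Real.exp (-(t * F V)) *
      (fibreIntegral s₁ (fun U => old₁ U * Real.exp (t * F U)) V
        * fibreIntegral s₂ (fun U => old₂ U * Real.exp (t * F U)) V) := by positivity
  have hN₁₂pos := lt_of_lt_of_le hLpos hsw.1
  rw [fibreIntegral_union_mul_eq hd hm₁ hm₂ h0₁ hC₁ hC₂ hI₁ hI₂ V, Real.log_div hN₁₂pos.ne' (mul_ne_zero hne₁ hne₂),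
    Real.log_mul hne₁ hne₂, Real.log_div hN₁pos.ne' hne₁, Real.log_div hN₂pos.ne' hne₂]
  refine le_of_eq_of_le (congrArg _ ?_) h
  ring

end SetupLevel

/-! ## §4 NE1 part (ii) typed: the PAIR (mixed second-difference) sensitivity of iterated averaging — hypothesis shape -/

section PairSensitivity

variable {P : Params} {G : Type*} [GaugeGroup G]

/-- HYPOTHESIS SHAPE — NE1 (ii), PAIR SENSITIVITY OF ITERATED AVERAGING (T4-DAG v2 §2 O3b (ii) "inter-component couplings
(strength `≲ |μ|θ_av^{2(K−k)}|Λ_i||Λ_i′|`)", §6 NE1 part (ii)): for all levels `k` and step counts `n` in the standing range,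
every CLOSED walk `(x, w)` of `T^{(k+n)}`, every two DISJOINT finite sets `Λ, Λ′` of level-`k` bonds and every "rectangle"
of configurations in the domain `dom k` — `V`; `V₁` (differs from `V` only on `Λ`); `V₂` (differs from `V` only on `Λ′`);
`V₁₂` (agrees with `V₁` off `Λ′` and with `V₂` off `Λ`) — the MIXED SECOND DIFFERENCE of `W = loopAt · (walk x w) ∘ avg^n`
is at most `C₂·|w|·|Λ|·|Λ′|·θ₂^n`.  NOT PRINTED; consumed only as a hypothesis (node O3b (ii)).  It holds trivially with
`(C₂, θ₂) = (4, 1)` (`loopPairOscBound_four_one`) and follows from NE1a `LoopOscBound av dom C_W θ` with `(2C_W, θ)`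
(`loopPairOscBound_of_loopOscBound`), so its content is a rate `θ₂ < θ_av` (target `θ₂ = θ_av²`: both perturbations must
propagate to the loop). [cite: Balaban1985Averaging, (11) p.19] -/
def LoopPairOscBound (av : ∀ j, Averaging P j G) (dom : ∀ j, Set (GaugeField P j G)) (C₂ θ₂ : ℝ) : Prop :=
  ∀ (k n : ℕ), k + n ≤ P.m + P.K → ∀ (x : Site P (k + n)) (w : List (Letter P.d)), walkEnd x w = x →
    ∀ (Λ Λ' : Finset (PBond P k)), Disjoint Λ Λ' → ∀ (V V₁ V₂ V₁₂ : GaugeField P k G),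
      V ∈ dom k → V₁ ∈ dom k → V₂ ∈ dom k → V₁₂ ∈ dom k →
      (∀ b, b ∉ Λ → V₁ b = V b) → (∀ b, b ∉ Λ' → V₂ b = V b) →
      (∀ b, b ∉ Λ' → V₁₂ b = V₁ b) → (∀ b, b ∉ Λ → V₁₂ b = V₂ b) →
        |loopAt (iterFrom av k n V₁₂) (walk x w) - loopAt (iterFrom av k n V₁) (walk x w)
          - loopAt (iterFrom av k n V₂) (walk x w) + loopAt (iterFrom av k n V) (walk x w)|
          ≤ C₂ * (w.length : ℝ) * (Λ.card : ℝ) * (Λ'.card : ℝ) * θ₂ ^ n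

/-- The pair-sensitivity hypothesis is monotone in its constants (non-negative target constant). [folklore] -/
theorem LoopPairOscBound.mono {av : ∀ j, Averaging P j G} {dom : ∀ j, Set (GaugeField P j G)} {C₂ C₂' θ₂ θ₂' : ℝ}
    (h : LoopPairOscBound av dom C₂ θ₂) (hC : C₂ ≤ C₂') (hC' : 0 ≤ C₂') (hθ0 : 0 ≤ θ₂) (hθ : θ₂ ≤ θ₂') :
    LoopPairOscBound av dom C₂' θ₂' := by
  intro k n hn x w hw Λ Λ' hΛ V V₁ V₂ V₁₂ hV hV₁ hV₂ hV₁₂ h₁ h₂ h₁₂ h₂₁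
  refine (h k n hn x w hw Λ Λ' hΛ V V₁ V₂ V₁₂ hV hV₁ hV₂ hV₁₂ h₁ h₂ h₁₂ h₂₁).trans ?_
  have hA : 0 ≤ (w.length : ℝ) * (Λ.card : ℝ) * (Λ'.card : ℝ) := by positivity
  calc C₂ * (w.length : ℝ) * (Λ.card : ℝ) * (Λ'.card : ℝ) * θ₂ ^ n
      = C₂ * ((w.length : ℝ) * (Λ.card : ℝ) * (Λ'.card : ℝ)) * θ₂ ^ n := by ring
    _ ≤ C₂' * ((w.length : ℝ) * (Λ.card : ℝ) * (Λ'.card : ℝ)) * θ₂' ^ n :=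
        mul_le_mul (mul_le_mul_of_nonneg_right hC hA) (pow_le_pow_left₀ hθ0 hθ n) (pow_nonneg hθ0 n)
          (mul_nonneg hC' hA)
    _ = C₂' * (w.length : ℝ) * (Λ.card : ℝ) * (Λ'.card : ℝ) * θ₂' ^ n := by ring

/-- Restricting the domains preserves the hypothesis. [folklore] -/
theorem LoopPairOscBound.anti {av : ∀ j, Averaging P j G} {dom dom' : ∀ j, Set (GaugeField P j G)} {C₂ θ₂ : ℝ}
    (h : LoopPairOscBound av dom C₂ θ₂) (hd : ∀ j, dom' j ⊆ dom j) : LoopPairOscBound av dom' C₂ θ₂ :=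
  fun k n hn x w hw Λ Λ' hΛ V V₁ V₂ V₁₂ hV hV₁ hV₂ hV₁₂ =>
    h k n hn x w hw Λ Λ' hΛ V V₁ V₂ V₁₂ (hd k hV) (hd k hV₁) (hd k hV₂) (hd k hV₁₂)

/-- NE1 (ii) FOLLOWS FROM NE1a WITH THE SAME RATE: two applications of `LoopOscBound av dom C_W θ` (to the pairs
`(V₁₂, V₂)` and `(V₁, V)`, each agreeing off `Λ`) bound the mixed difference by `2C_W·|w|·|Λ|·θ^n ≤ 2C_W·|w|·|Λ|·|Λ′|·θ^n`
when `Λ′ ≠ ∅`, and it vanishes when `Λ′ = ∅`.  Hence the CONTENT of NE1 (ii) beyond NE1a is only an improved rate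
`θ₂ < θ`. [folklore] -/
theorem loopPairOscBound_of_loopOscBound {av : ∀ j, Averaging P j G} {dom : ∀ j, Set (GaugeField P j G)} {C_W θ : ℝ}
    (h : LoopOscBound av dom C_W θ) (hC : 0 ≤ C_W) (hθ : 0 ≤ θ) : LoopPairOscBound av dom (2 * C_W) θ := by
  intro k n hn x w hw Λ Λ' _ V V₁ V₂ V₁₂ hV hV₁ hV₂ hV₁₂ h₁ _ _ h₂₁
  by_cases hΛ' : Λ' = ∅
  · subst hΛ'
    have e₂ : V₂ = V := funext fun b => ‹∀ b, b ∉ (∅ : Finset (PBond P k)) → V₂ b = V b› b (Finset.notMem_empty b)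
    have e₁₂ : V₁₂ = V₁ := funext fun b => ‹∀ b, b ∉ (∅ : Finset (PBond P k)) → V₁₂ b = V₁ b› b (Finset.notMem_empty b)
    rw [e₂, e₁₂]
    have : loopAt (iterFrom av k n V₁) (walk x w) - loopAt (iterFrom av k n V₁) (walk x w)
        - loopAt (iterFrom av k n V) (walk x w) + loopAt (iterFrom av k n V) (walk x w) = 0 := by ring
    rw [this, abs_zero]
    positivity
  have hcard : (1 : ℝ) ≤ (Λ'.card : ℝ) := by
    exact_mod_cast Finset.one_le_card.mpr (Finset.nonempty_iff_ne_empty.mpr hΛ')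
  have hA := h k n hn x w hw Λ V₁₂ V₂ hV₁₂ hV₂ h₂₁
  have hB := h k n hn x w hw Λ V₁ V hV₁ hV h₁
  have hnn : 0 ≤ C_W * (w.length : ℝ) * (Λ.card : ℝ) * θ ^ n := by positivity
  calc |loopAt (iterFrom av k n V₁₂) (walk x w) - loopAt (iterFrom av k n V₁) (walk x w)
          - loopAt (iterFrom av k n V₂) (walk x w) + loopAt (iterFrom av k n V) (walk x w)|
      = |(loopAt (iterFrom av k n V₁₂) (walk x w) - loopAt (iterFrom av k n V₂) (walk x w))
          - (loopAt (iterFrom av k n V₁) (walk x w) - loopAt (iterFrom av k n V) (walk x w))| := by ring_nf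
    _ ≤ |loopAt (iterFrom av k n V₁₂) (walk x w) - loopAt (iterFrom av k n V₂) (walk x w)|
          + |loopAt (iterFrom av k n V₁) (walk x w) - loopAt (iterFrom av k n V) (walk x w)| := abs_sub _ _
    _ ≤ C_W * (w.length : ℝ) * (Λ.card : ℝ) * θ ^ n + C_W * (w.length : ℝ) * (Λ.card : ℝ) * θ ^ n := add_le_add hA hB
    _ = 2 * C_W * (w.length : ℝ) * (Λ.card : ℝ) * 1 * θ ^ n := by ring
    _ ≤ 2 * C_W * (w.length : ℝ) * (Λ.card : ℝ) * (Λ'.card : ℝ) * θ ^ n := by gcongr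

/-- CONSISTENCY, AND WHERE THE CONTENT IS: the shape holds TRIVIALLY with `(C₂, θ₂) = (4, 1)` (from `loopOscBound_two_one`),
so the entire content of NE1 (ii) is a rate `θ₂ < 1` — for the located requirement of the cell, `θ₂ ≤ θ_av²` — uniform in
`k, n, Λ, Λ′`, which nothing in this module (or in print) provides. [folklore] -/
theorem loopPairOscBound_four_one [MeasurableSpace G] [RegularGaugeGroup G] (av : ∀ j, Averaging P j G)
    (dom : ∀ j, Set (GaugeField P j G)) : LoopPairOscBound av dom 4 1 := by
  have h := loopPairOscBound_of_loopOscBound (loopOscBound_two_one av dom) zero_le_two zero_le_one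
  norm_num at h
  exact h

/-- LOCALITY OF THE PAIR TERM: if the walk AVOIDS the `n`-step influence set of a set of sites `S` containing the sources
of the bonds of `Λ`, the mixed difference VANISHES identically (both `Λ`-perturbations are invisible to the loop:
`W(V₁₂) = W(V₂)` and `W(V₁) = W(V)` by `loopAt_iterFrom_eq_of_avoids`) — the observable-attached pair couplings live on
pairs of components BOTH of which influence the loop. [folklore] -/
theorem mixedDiff_eq_zero_of_avoids (av : ∀ j, Averaging P j G) {k : ℕ} {S : Set (Site P k)} {Λ : Finset (PBond P k)}
    (hS : ∀ b ∈ Λ, b.src ∈ S) {V V₁ V₂ V₁₂ : GaugeField P k G}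
    (h₁ : ∀ b, b ∉ Λ → V₁ b = V b) (h₂₁ : ∀ b, b ∉ Λ → V₁₂ b = V₂ b)
    (n : ℕ) (hn : k + n ≤ P.m + P.K) (γ : List (LStep P (k + n))) (hγ : ∀ s ∈ γ, s.bond.src ∉ infl S n) :
    loopAt (iterFrom av k n V₁₂) γ - loopAt (iterFrom av k n V₁) γ
      - loopAt (iterFrom av k n V₂) γ + loopAt (iterFrom av k n V) γ = 0 := by
  have hA : AgreeOff S V₁₂ V₂ := fun b hb => h₂₁ b fun hbΛ => hb (hS b hbΛ)
  have hB : AgreeOff S V₁ V := fun b hb => h₁ b fun hbΛ => hb (hS b hbΛ)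
  rw [loopAt_iterFrom_eq_of_avoids av hA n hn γ hγ, loopAt_iterFrom_eq_of_avoids av hB n hn γ hγ]
  ring

/-- … and symmetrically for the second set: if the walk avoids the influence set of a set of sites containing the sources
of the bonds of `Λ′`, the mixed difference vanishes (`W(V₁₂) = W(V₁)`, `W(V₂) = W(V)`). [folklore] -/
theorem mixedDiff_eq_zero_of_avoids' (av : ∀ j, Averaging P j G) {k : ℕ} {S' : Set (Site P k)} {Λ' : Finset (PBond P k)}
    (hS' : ∀ b ∈ Λ', b.src ∈ S') {V V₁ V₂ V₁₂ : GaugeField P k G}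
    (h₂ : ∀ b, b ∉ Λ' → V₂ b = V b) (h₁₂ : ∀ b, b ∉ Λ' → V₁₂ b = V₁ b)
    (n : ℕ) (hn : k + n ≤ P.m + P.K) (γ : List (LStep P (k + n))) (hγ : ∀ s ∈ γ, s.bond.src ∉ infl S' n) :
    loopAt (iterFrom av k n V₁₂) γ - loopAt (iterFrom av k n V₁) γ
      - loopAt (iterFrom av k n V₂) γ + loopAt (iterFrom av k n V) γ = 0 := by
  have hA : AgreeOff S' V₁₂ V₁ := fun b hb => h₁₂ b fun hbΛ => hb (hS' b hbΛ)
  have hB : AgreeOff S' V₂ V := fun b hb => h₂ b fun hbΛ => hb (hS' b hbΛ)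
  rw [loopAt_iterFrom_eq_of_avoids av hA n hn γ hγ, loopAt_iterFrom_eq_of_avoids av hB n hn γ hγ]
  ring

/-- FIBREWISE (rectangle-of-updates) FORM: under `LoopPairOscBound`, for disjoint fibres `Λ, Λ′` and fibre coordinates
`y, z`, the four configurations `V, V←y, V←z, V←y←z` (all in the domain) have mixed loop difference at most
`C₂·|w|·|Λ|·|Λ′|·θ₂^n` — the form consumed by §3. [folklore] -/
theorem LoopPairOscBound.updateFinset {av : ∀ j, Averaging P j G} {dom : ∀ j, Set (GaugeField P j G)} {C₂ θ₂ : ℝ}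
    (h : LoopPairOscBound av dom C₂ θ₂) {k : ℕ} [DecidableEq (PBond P k)] (n : ℕ) (hn : k + n ≤ P.m + P.K)
    (x : Site P (k + n)) (w : List (Letter P.d)) (hw : walkEnd x w = x) {Λ Λ' : Finset (PBond P k)} (hΛ : Disjoint Λ Λ')
    (V : GaugeField P k G) (y : Λ → G) (z : Λ' → G) (hV : V ∈ dom k) (hV₁ : Function.updateFinset V Λ y ∈ dom k)
    (hV₂ : Function.updateFinset V Λ' z ∈ dom k)
    (hV₁₂ : Function.updateFinset (Function.updateFinset V Λ y) Λ' z ∈ dom k) :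
    |loopAt (iterFrom av k n (Function.updateFinset (Function.updateFinset V Λ y) Λ' z)) (walk x w)
      - loopAt (iterFrom av k n (Function.updateFinset V Λ y)) (walk x w)
      - loopAt (iterFrom av k n (Function.updateFinset V Λ' z)) (walk x w) + loopAt (iterFrom av k n V) (walk x w)|
      ≤ C₂ * (w.length : ℝ) * (Λ.card : ℝ) * (Λ'.card : ℝ) * θ₂ ^ n := by
  refine h k n hn x w hw Λ Λ' hΛ V _ _ _ hV hV₁ hV₂ hV₁₂ (fun b hb => ?_) (fun b hb => ?_) (fun b hb => ?_) (fun b hb => ?_)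
  · simp only [Function.updateFinset, dif_neg hb]
  · simp only [Function.updateFinset, dif_neg hb]
  · simp only [Function.updateFinset, dif_neg hb]
  · rw [updateFinset_updateFinset_comm hΛ V y z]
    simp only [Function.updateFinset, dif_neg hb]

end PairSensitivity

/-! ## §5 Where NE1 (ii) is spent: the coupling remainder of the loop dressing across two components of one term -/

section Consumer

variable {P : Params} {j : ℕ} {G : Type*} [GaugeGroup G] [MeasurableSpace G] [HaarData G]
variable [DecidableEq (PBond P j)]

/-- WHERE NE1 (ii) IS SPENT (one basic step, one term, two components): under `LoopPairOscBound av dom C₂ θ₂`, for a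
closed walk at level `j + n ≤ m + K`, integrated densities `old₁` (`Λ₂`-independent), `old₂` (`Λ₁`-independent) supported
in the domain `dom j` and a base point `V ∈ dom j`, the dressing `w = exp(t·W_C(avg^n ·))` (`T4OscSandwich.loopDressing`)
satisfies the two-body coupling sandwich of §3 with  `δ = C₂·|w|·|Λ₁|·|Λ₂|·θ₂^n`:  the jointly dressed fluctuation
integral over `Λ₁ ∪ Λ₂` equals `e^{−tW(V)}·N₁·N₂` up to `exp(±|t|·C₂|w||Λ₁||Λ₂|θ₂^n)`. [folklore] -/
theorem fibreIntegral_union_loopDressing_sandwich [RegularGaugeGroup G] {av : ∀ i, Averaging P i G}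
    {dom : ∀ i, Set (GaugeField P i G)} {C₂ θ₂ : ℝ} (hW : LoopPairOscBound av dom C₂ θ₂)
    (n : ℕ) (hn : j + n ≤ P.m + P.K) (x : Site P (j + n)) (w : List (Letter P.d)) (hw : walkEnd x w = x)
    (hFm : Measurable (loopDressing av j n x w))
    {s₁ s₂ : Finset (PBond P j)} (hd : Disjoint s₁ s₂) {old₁ old₂ : Density P j G}
    (hm₁ : Measurable old₁) (hm₂ : Measurable old₂) (h0₁ : ∀ U, 0 ≤ old₁ U) (h0₂ : ∀ U, 0 ≤ old₂ U)
    {C : ℝ} (hC₁ : ∀ U, old₁ U ≤ C) (hC₂ : ∀ U, old₂ U ≤ C) (hI₁ : FibreIndep s₂ old₁) (hI₂ : FibreIndep s₁ old₂)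
    (hdom₁ : ∀ U, old₁ U ≠ 0 → U ∈ dom j) (hdom₂ : ∀ U, old₂ U ≠ 0 → U ∈ dom j)
    (t : ℝ) (V : GaugeField P j G) (hV : V ∈ dom j) :
    Real.exp (-(|t| * (C₂ * (w.length : ℝ) * (s₁.card : ℝ) * (s₂.card : ℝ) * θ₂ ^ n)))
        * Real.exp (-(t * loopDressing av j n x w V)) *
        (fibreIntegral s₁ (fun U => old₁ U * Real.exp (t * loopDressing av j n x w U)) V
          * fibreIntegral s₂ (fun U => old₂ U * Real.exp (t * loopDressing av j n x w U)) V)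
      ≤ fibreIntegral (s₁ ∪ s₂) (fun U => old₁ U * old₂ U * Real.exp (t * loopDressing av j n x w U)) V ∧
    fibreIntegral (s₁ ∪ s₂) (fun U => old₁ U * old₂ U * Real.exp (t * loopDressing av j n x w U)) V
      ≤ Real.exp (|t| * (C₂ * (w.length : ℝ) * (s₁.card : ℝ) * (s₂.card : ℝ) * θ₂ ^ n))
        * Real.exp (-(t * loopDressing av j n x w V)) *
        (fibreIntegral s₁ (fun U => old₁ U * Real.exp (t * loopDressing av j n x w U)) V
          * fibreIntegral s₂ (fun U => old₂ U * Real.exp (t * loopDressing av j n x w U)) V) := by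
  refine fibreIntegral_union_exp_sandwich hd (loopDressing av j n x w) hm₁ hm₂ hFm h0₁ h0₂ hC₁ hC₂ hI₁ hI₂
    (B := 1) (fun U => abs_loopAt_le_one _ _) t _ V (fun y z hy hz => ?_)
  have hV₁ : updateFinset V s₁ y ∈ dom j := hdom₁ _ hy
  have hV₂ : updateFinset V s₂ z ∈ dom j := hdom₂ _ hz
  have hV₁₂ : updateFinset (updateFinset V s₁ y) s₂ z ∈ dom j := by
    refine hdom₁ _ ?_
    rw [hI₁ (updateFinset V s₁ y) z]; exact hy
  exact hW.updateFinset n hn x w hw hd V y z hV hV₁ hV₂ hV₁₂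

end Consumer

/-! ## §6 (v2) Separation: rectangles lift up the block tower; the pair shape with a gain per level of separation -/

section Separation

variable {P : Params} {G : Type*} [GaugeGroup G]

/-- RECTANGLES LIFT ALONG THE INFLUENCE SETS (the structural half of "locality across the tube"): if `V, V₁, V₂, V₁₂` is
a rectangle over the bond sets `Λ, Λ′` whose sources lie in the site sets `S, S′`, then after `n′` averaging steps the four
averaged configurations form a rectangle over the influence sets `infl S n′`, `infl S′ n′` — four instances of
`T4AvgSensitivity.iterFrom_agreeOff` (tree axiom `Setup.Averaging.local_dep` iterated).  While these two site sets are
DISJOINT, no level-`(k + n′)` bond variable depends on both perturbations: the two components "have not met" by that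
level. [folklore] -/
theorem rectangle_iterFrom (av : ∀ j, Averaging P j G) {k : ℕ} {S S' : Set (Site P k)} {Λ Λ' : Finset (PBond P k)}
    (hS : ∀ b ∈ Λ, b.src ∈ S) (hS' : ∀ b ∈ Λ', b.src ∈ S') {V V₁ V₂ V₁₂ : GaugeField P k G}
    (h₁ : ∀ b, b ∉ Λ → V₁ b = V b) (h₂ : ∀ b, b ∉ Λ' → V₂ b = V b)
    (h₁₂ : ∀ b, b ∉ Λ' → V₁₂ b = V₁ b) (h₂₁ : ∀ b, b ∉ Λ → V₁₂ b = V₂ b) (n' : ℕ) (hn' : k + n' ≤ P.m + P.K) :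
    AgreeOff (infl S n') (iterFrom av k n' V₁) (iterFrom av k n' V) ∧
      AgreeOff (infl S' n') (iterFrom av k n' V₂) (iterFrom av k n' V) ∧
      AgreeOff (infl S' n') (iterFrom av k n' V₁₂) (iterFrom av k n' V₁) ∧
      AgreeOff (infl S n') (iterFrom av k n' V₁₂) (iterFrom av k n' V₂) :=
  ⟨iterFrom_agreeOff av (fun b hb => h₁ b fun hbΛ => hb (hS b hbΛ)) n' hn',
    iterFrom_agreeOff av (fun b hb => h₂ b fun hbΛ => hb (hS' b hbΛ)) n' hn',
    iterFrom_agreeOff av (fun b hb => h₁₂ b fun hbΛ => hb (hS' b hbΛ)) n' hn',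
    iterFrom_agreeOff av (fun b hb => h₂₁ b fun hbΛ => hb (hS b hbΛ)) n' hn'⟩

/-- HYPOTHESIS SHAPE — NE1 (ii) WITH SEPARATION (cell typing, NOT PRINTED; consumed only as a hypothesis; v2): as
`LoopPairOscBound`, with the sources of `Λ`, `Λ′` inside site sets `S`, `S′`, and for every `n′ ≤ n` such that the
influence sets `infl S n′`, `infl S′ n′` are still DISJOINT (the two components have not met by level `k + n′`,
`rectangle_iterFrom`) the mixed difference is at most `C₂·|w|·|Λ|·|Λ′|·θ₁ⁿ·θₓ^{n′}`: a first-order rate `θ₁` over all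
`n` levels times an EXTRA factor `θₓ ≤ 1` per level of separation.  With `θₓ = 1` it is `LoopPairOscBound av dom C₂ θ₁`
(`.of_pair`), so it holds trivially with `(4, 1, 1)` and follows from NE1a with `(2C_W, θ, 1)`; a uniform pair rate
`θ₂ ≤ θ₁·θₓ` gives it (`.of_uniform`).  WHY THIS SHAPE (cell record `t4/T4-EST-O3Eii.md` §3.5 (F7), [analysis], NOT a
kernel fact): in the non-abelian model the mixed second-order response of ONE averaging step (15) to two bond changes read
by a common contour is of the size of a FIRST-order response (commutator terms), so a UNIFORM rate `θ₂ < θ₁` is not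
expected to hold, whereas two components first read together at level `k + n′` are expected to couple with strength
`≍ θ₁^{n + n′}` — this shape with `θₓ = θ₁`; in the abelian linearised model the averaged field is exactly linear and the
uniform rate `θ₂ = θ₁²` holds (`.of_uniform` with `θₓ = θ₁`, all `n′`).  The size-weighted sibling of the uniform shape is
`T4AvgDerivBound.LoopPairDerivBound` (row T4-O3c.E2); the same remark applies to its rate. [cite: Balaban1985Averaging, (15) p.19] -/
def LoopPairOscBoundSep (av : ∀ j, Averaging P j G) (dom : ∀ j, Set (GaugeField P j G)) (C₂ θ₁ θₓ : ℝ) : Prop :=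
  ∀ (k n : ℕ), k + n ≤ P.m + P.K → ∀ (x : Site P (k + n)) (w : List (Letter P.d)), walkEnd x w = x →
    ∀ (Λ Λ' : Finset (PBond P k)), Disjoint Λ Λ' → ∀ (S S' : Set (Site P k)),
      (∀ b ∈ Λ, b.src ∈ S) → (∀ b ∈ Λ', b.src ∈ S') → ∀ (n' : ℕ), n' ≤ n → Disjoint (infl S n') (infl S' n') →
      ∀ (V V₁ V₂ V₁₂ : GaugeField P k G), V ∈ dom k → V₁ ∈ dom k → V₂ ∈ dom k → V₁₂ ∈ dom k →
      (∀ b, b ∉ Λ → V₁ b = V b) → (∀ b, b ∉ Λ' → V₂ b = V b) →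
      (∀ b, b ∉ Λ' → V₁₂ b = V₁ b) → (∀ b, b ∉ Λ → V₁₂ b = V₂ b) →
        |loopAt (iterFrom av k n V₁₂) (walk x w) - loopAt (iterFrom av k n V₁) (walk x w)
          - loopAt (iterFrom av k n V₂) (walk x w) + loopAt (iterFrom av k n V) (walk x w)|
          ≤ C₂ * (w.length : ℝ) * (Λ.card : ℝ) * (Λ'.card : ℝ) * θ₁ ^ n * θₓ ^ n'

/-- No separation gain claimed (`θₓ = 1`): the separated shape IS the uniform pair shape with the first-order rate.
[folklore] -/
theorem LoopPairOscBoundSep.of_pair {av : ∀ j, Averaging P j G} {dom : ∀ j, Set (GaugeField P j G)} {C₂ θ : ℝ}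
    (h : LoopPairOscBound av dom C₂ θ) : LoopPairOscBoundSep av dom C₂ θ 1 := by
  intro k n hn x w hw Λ Λ' hΛ S S' _ _ n' _ _ V V₁ V₂ V₁₂ hV hV₁ hV₂ hV₁₂ h₁ h₂ h₁₂ h₂₁
  rw [one_pow, mul_one]
  exact h k n hn x w hw Λ Λ' hΛ V V₁ V₂ V₁₂ hV hV₁ hV₂ hV₁₂ h₁ h₂ h₁₂ h₂₁

/-- Conversely the `n′ = 0` clause of the separated shape is the uniform pair shape with rate `θ₁` — for pairs whose
SOURCE site sets can be chosen disjoint (e.g. components at positive distance). [folklore] -/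
theorem LoopPairOscBoundSep.apply_zero {av : ∀ j, Averaging P j G} {dom : ∀ j, Set (GaugeField P j G)} {C₂ θ₁ θₓ : ℝ}
    (h : LoopPairOscBoundSep av dom C₂ θ₁ θₓ) {k n : ℕ} (hn : k + n ≤ P.m + P.K) (x : Site P (k + n))
    (w : List (Letter P.d)) (hw : walkEnd x w = x) {Λ Λ' : Finset (PBond P k)} (hΛ : Disjoint Λ Λ')
    {S S' : Set (Site P k)} (hS : ∀ b ∈ Λ, b.src ∈ S) (hS' : ∀ b ∈ Λ', b.src ∈ S') (hSS' : Disjoint S S')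
    {V V₁ V₂ V₁₂ : GaugeField P k G} (hV : V ∈ dom k) (hV₁ : V₁ ∈ dom k) (hV₂ : V₂ ∈ dom k) (hV₁₂ : V₁₂ ∈ dom k)
    (h₁ : ∀ b, b ∉ Λ → V₁ b = V b) (h₂ : ∀ b, b ∉ Λ' → V₂ b = V b)
    (h₁₂ : ∀ b, b ∉ Λ' → V₁₂ b = V₁ b) (h₂₁ : ∀ b, b ∉ Λ → V₁₂ b = V₂ b) :
    |loopAt (iterFrom av k n V₁₂) (walk x w) - loopAt (iterFrom av k n V₁) (walk x w)
        - loopAt (iterFrom av k n V₂) (walk x w) + loopAt (iterFrom av k n V) (walk x w)|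
      ≤ C₂ * (w.length : ℝ) * (Λ.card : ℝ) * (Λ'.card : ℝ) * θ₁ ^ n := by
  have := h k n hn x w hw Λ Λ' hΛ S S' hS hS' 0 (Nat.zero_le n) (by simpa [infl] using hSS') V V₁ V₂ V₁₂ hV hV₁ hV₂
    hV₁₂ h₁ h₂ h₁₂ h₂₁
  simpa using this

/-- A UNIFORM pair rate `θ₂ ≤ θ₁·θₓ` (`0 ≤ θₓ ≤ 1`) gives the separated shape: `θ₂ⁿ ≤ θ₁ⁿθₓⁿ ≤ θ₁ⁿθₓ^{n′}` for
`n′ ≤ n`.  (The abelian linearised instance: `θ₂ = θ₁²`, `θₓ = θ₁`.) [folklore] -/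
theorem LoopPairOscBoundSep.of_uniform {av : ∀ j, Averaging P j G} {dom : ∀ j, Set (GaugeField P j G)}
    {C₂ θ₂ θ₁ θₓ : ℝ} (h : LoopPairOscBound av dom C₂ θ₂) (hC : 0 ≤ C₂) (hθ₂ : 0 ≤ θ₂) (hθ₁ : 0 ≤ θ₁)
    (hθₓ0 : 0 ≤ θₓ) (hθₓ1 : θₓ ≤ 1) (hle : θ₂ ≤ θ₁ * θₓ) : LoopPairOscBoundSep av dom C₂ θ₁ θₓ := by
  intro k n hn x w hw Λ Λ' hΛ S S' _ _ n' hn' _ V V₁ V₂ V₁₂ hV hV₁ hV₂ hV₁₂ h₁ h₂ h₁₂ h₂₁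
  have hb := h k n hn x w hw Λ Λ' hΛ V V₁ V₂ V₁₂ hV hV₁ hV₂ hV₁₂ h₁ h₂ h₁₂ h₂₁
  have hK : 0 ≤ C₂ * (w.length : ℝ) * (Λ.card : ℝ) * (Λ'.card : ℝ) := by positivity
  have hp1 : θ₂ ^ n ≤ θ₁ ^ n * θₓ ^ n := by
    rw [← mul_pow]
    exact pow_le_pow_left₀ hθ₂ hle n
  have hp2 : θ₁ ^ n * θₓ ^ n ≤ θ₁ ^ n * θₓ ^ n' :=
    mul_le_mul_of_nonneg_left (pow_le_pow_of_le_one hθₓ0 hθₓ1 hn') (pow_nonneg hθ₁ n)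
  calc |loopAt (iterFrom av k n V₁₂) (walk x w) - loopAt (iterFrom av k n V₁) (walk x w)
          - loopAt (iterFrom av k n V₂) (walk x w) + loopAt (iterFrom av k n V) (walk x w)|
      ≤ C₂ * (w.length : ℝ) * (Λ.card : ℝ) * (Λ'.card : ℝ) * θ₂ ^ n := hb
    _ ≤ C₂ * (w.length : ℝ) * (Λ.card : ℝ) * (Λ'.card : ℝ) * (θ₁ ^ n * θₓ ^ n') :=
        mul_le_mul_of_nonneg_left (hp1.trans hp2) hK
    _ = C₂ * (w.length : ℝ) * (Λ.card : ℝ) * (Λ'.card : ℝ) * θ₁ ^ n * θₓ ^ n' := by ring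

/-- The separated shape is antitone in the domain. [folklore] -/
theorem LoopPairOscBoundSep.anti {av : ∀ j, Averaging P j G} {dom dom' : ∀ j, Set (GaugeField P j G)} {C₂ θ₁ θₓ : ℝ}
    (h : LoopPairOscBoundSep av dom C₂ θ₁ θₓ) (hd : ∀ j, dom' j ⊆ dom j) : LoopPairOscBoundSep av dom' C₂ θ₁ θₓ :=
  fun k n hn x w hw Λ Λ' hΛ S S' hS hS' n' hn' hsep V V₁ V₂ V₁₂ hV hV₁ hV₂ hV₁₂ =>
    h k n hn x w hw Λ Λ' hΛ S S' hS hS' n' hn' hsep V V₁ V₂ V₁₂ (hd k hV) (hd k hV₁) (hd k hV₂) (hd k hV₁₂)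

/-- NE1a gives the separated shape with no separation gain: `(2C_W, θ, 1)`. [folklore] -/
theorem loopPairOscBoundSep_of_loopOscBound {av : ∀ j, Averaging P j G} {dom : ∀ j, Set (GaugeField P j G)} {C_W θ : ℝ}
    (h : LoopOscBound av dom C_W θ) (hC : 0 ≤ C_W) (hθ : 0 ≤ θ) : LoopPairOscBoundSep av dom (2 * C_W) θ 1 :=
  LoopPairOscBoundSep.of_pair (loopPairOscBound_of_loopOscBound h hC hθ)

/-- CONSISTENCY: the separated shape holds TRIVIALLY with `(C₂, θ₁, θₓ) = (4, 1, 1)`; its content is a pair of rates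
`θ₁ < 1` (NE1a's) and `θₓ < 1` (the separation gain), NOT PRINTED and not provided here. [folklore] -/
theorem loopPairOscBoundSep_four_one_one [MeasurableSpace G] [RegularGaugeGroup G] (av : ∀ j, Averaging P j G)
    (dom : ∀ j, Set (GaugeField P j G)) : LoopPairOscBoundSep av dom 4 1 1 :=
  LoopPairOscBoundSep.of_pair (loopPairOscBound_four_one av dom)

/-- FIBREWISE (rectangle-of-updates) FORM of the separated shape. [folklore] -/
theorem LoopPairOscBoundSep.updateFinset {av : ∀ j, Averaging P j G} {dom : ∀ j, Set (GaugeField P j G)}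
    {C₂ θ₁ θₓ : ℝ} (h : LoopPairOscBoundSep av dom C₂ θ₁ θₓ) {k : ℕ} [DecidableEq (PBond P k)] (n : ℕ)
    (hn : k + n ≤ P.m + P.K) (x : Site P (k + n)) (w : List (Letter P.d)) (hw : walkEnd x w = x)
    {Λ Λ' : Finset (PBond P k)} (hΛ : Disjoint Λ Λ') {S S' : Set (Site P k)} (hS : ∀ b ∈ Λ, b.src ∈ S)
    (hS' : ∀ b ∈ Λ', b.src ∈ S') (n' : ℕ) (hn' : n' ≤ n) (hsep : Disjoint (infl S n') (infl S' n'))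
    (V : GaugeField P k G) (y : Λ → G) (z : Λ' → G) (hV : V ∈ dom k) (hV₁ : Function.updateFinset V Λ y ∈ dom k)
    (hV₂ : Function.updateFinset V Λ' z ∈ dom k)
    (hV₁₂ : Function.updateFinset (Function.updateFinset V Λ y) Λ' z ∈ dom k) :
    |loopAt (iterFrom av k n (Function.updateFinset (Function.updateFinset V Λ y) Λ' z)) (walk x w)
      - loopAt (iterFrom av k n (Function.updateFinset V Λ y)) (walk x w)
      - loopAt (iterFrom av k n (Function.updateFinset V Λ' z)) (walk x w) + loopAt (iterFrom av k n V) (walk x w)|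
      ≤ C₂ * (w.length : ℝ) * (Λ.card : ℝ) * (Λ'.card : ℝ) * θ₁ ^ n * θₓ ^ n' := by
  refine h k n hn x w hw Λ Λ' hΛ S S' hS hS' n' hn' hsep V _ _ _ hV hV₁ hV₂ hV₁₂ (fun b hb => ?_) (fun b hb => ?_)
    (fun b hb => ?_) (fun b hb => ?_)
  · simp only [Function.updateFinset, dif_neg hb]
  · simp only [Function.updateFinset, dif_neg hb]
  · simp only [Function.updateFinset, dif_neg hb]
  · rw [updateFinset_updateFinset_comm hΛ V y z]
    simp only [Function.updateFinset, dif_neg hb]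

end Separation

section ConsumerSep

variable {P : Params} {j : ℕ} {G : Type*} [GaugeGroup G] [MeasurableSpace G] [HaarData G]
variable [DecidableEq (PBond P j)]

/-- WHERE THE SEPARATED SHAPE IS SPENT: as `fibreIntegral_union_loopDressing_sandwich`, for two components whose source
site sets `S ⊇ src Λ₁`, `S′ ⊇ src Λ₂` have DISJOINT `n′`-step influence sets (`n′ ≤ n`): the two-body coupling sandwich
of §3 holds with the improved remainder  `δ = C₂·|w|·|Λ₁|·|Λ₂|·θ₁ⁿ·θₓ^{n′}`. [folklore] -/
theorem fibreIntegral_union_loopDressing_sandwich_sep [RegularGaugeGroup G] {av : ∀ i, Averaging P i G}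
    {dom : ∀ i, Set (GaugeField P i G)} {C₂ θ₁ θₓ : ℝ} (hW : LoopPairOscBoundSep av dom C₂ θ₁ θₓ)
    (n : ℕ) (hn : j + n ≤ P.m + P.K) (x : Site P (j + n)) (w : List (Letter P.d)) (hw : walkEnd x w = x)
    (hFm : Measurable (loopDressing av j n x w))
    {s₁ s₂ : Finset (PBond P j)} (hd : Disjoint s₁ s₂) {S S' : Set (Site P j)} (hS : ∀ b ∈ s₁, b.src ∈ S)
    (hS' : ∀ b ∈ s₂, b.src ∈ S') (n' : ℕ) (hn' : n' ≤ n) (hsep : Disjoint (infl S n') (infl S' n'))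
    {old₁ old₂ : Density P j G}
    (hm₁ : Measurable old₁) (hm₂ : Measurable old₂) (h0₁ : ∀ U, 0 ≤ old₁ U) (h0₂ : ∀ U, 0 ≤ old₂ U)
    {C : ℝ} (hC₁ : ∀ U, old₁ U ≤ C) (hC₂ : ∀ U, old₂ U ≤ C) (hI₁ : FibreIndep s₂ old₁) (hI₂ : FibreIndep s₁ old₂)
    (hdom₁ : ∀ U, old₁ U ≠ 0 → U ∈ dom j) (hdom₂ : ∀ U, old₂ U ≠ 0 → U ∈ dom j)
    (t : ℝ) (V : GaugeField P j G) (hV : V ∈ dom j) :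
    Real.exp (-(|t| * (C₂ * (w.length : ℝ) * (s₁.card : ℝ) * (s₂.card : ℝ) * θ₁ ^ n * θₓ ^ n')))
        * Real.exp (-(t * loopDressing av j n x w V)) *
        (fibreIntegral s₁ (fun U => old₁ U * Real.exp (t * loopDressing av j n x w U)) V
          * fibreIntegral s₂ (fun U => old₂ U * Real.exp (t * loopDressing av j n x w U)) V)
      ≤ fibreIntegral (s₁ ∪ s₂) (fun U => old₁ U * old₂ U * Real.exp (t * loopDressing av j n x w U)) V ∧
    fibreIntegral (s₁ ∪ s₂) (fun U => old₁ U * old₂ U * Real.exp (t * loopDressing av j n x w U)) V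
      ≤ Real.exp (|t| * (C₂ * (w.length : ℝ) * (s₁.card : ℝ) * (s₂.card : ℝ) * θ₁ ^ n * θₓ ^ n'))
        * Real.exp (-(t * loopDressing av j n x w V)) *
        (fibreIntegral s₁ (fun U => old₁ U * Real.exp (t * loopDressing av j n x w U)) V
          * fibreIntegral s₂ (fun U => old₂ U * Real.exp (t * loopDressing av j n x w U)) V) := by
  refine fibreIntegral_union_exp_sandwich hd (loopDressing av j n x w) hm₁ hm₂ hFm h0₁ h0₂ hC₁ hC₂ hI₁ hI₂
    (B := 1) (fun U => abs_loopAt_le_one _ _) t _ V (fun y z hy hz => ?_)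
  have hV₁ : updateFinset V s₁ y ∈ dom j := hdom₁ _ hy
  have hV₂ : updateFinset V s₂ z ∈ dom j := hdom₂ _ hz
  have hV₁₂ : updateFinset (updateFinset V s₁ y) s₂ z ∈ dom j := by
    refine hdom₁ _ ?_
    rw [hI₁ (updateFinset V s₁ y) z]; exact hy
  exact hW.updateFinset n hn x w hw hd hS hS' n' hn' hsep V y z hV hV₁ hV₂ hV₁₂

end ConsumerSep

end Literature.MathematicalPhysics.QuantumFieldTheory.Balaban1983to89.T4JointDressing
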